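import Summits.Langlands.Langlands.Theses.RationalPeriodQuarter
import Literature.NumberTheory.Automorphic.BLZPeriodCocycleProofs
import Literature.NumberTheory.Automorphic.BLZPeriodCocycleAnalyticityProofs
import Literature.NumberTheory.Automorphic.PiecewiseRational
import Literature.NumberTheory.Automorphic.PrincipalSeriesLineModel
import Literature.NumberTheory.EllipticCurves.HeckeOperatorsGamma1QExpansionProofs
import Literature.NumberTheory.Automorphic.InvariantLaplacian
import Literature.NumberTheory.Automorphic.SmallEigenbasisIndependence

/-!
# Line `decomposition` for the crux `HeckePreservesRationalPeriods`
(item stmt-Langlands-2807, route `Langlands/RationalPeriodQuarter`; crux-strategist, RESTATED re-audit / BC2 redirect)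

The crux (rank 5 of the route; "Hecke stability of the ℚ-structure": for `p ∤ N` and
`σ ∈ Γ₀(N)` with `d_σ ≡ p (N)`, the normalised Hecke operator `T'_p u = p^{-1/2}(Σ_{b<p} u((z+b)/p) + u(σ(pz)))`
maps the quarter cusp forms `S(N)` to `S(N)` AND maps the forms with a RATIONAL PERIOD CLASS to forms with
a rational period class) is exhibited as DERIVED from three typed pieces, none of which is the crux or the
summit reworded, by the sorry-free composition `heckePreservesRationalPeriods_of_subs`
(std axioms; ≈ 400 lines of this file are that proof):

* `stub_heckeStableQuarterForms` (= child `HeckeStableQuarterForms`, crux) — ANALYSIS OF FORMS: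
  `T'_p S(N) ⊆ S(N)` (`C²`, `Γ₁(N)`-invariance by the coset permutation, eigenvalue `1/4` by the
  `GL₂⁺(ℝ)`-invariance of `Δ`, boundedness). Diamond–Shurman Prop. 5.2.1 for Maass forms of weight 0.
  **PROVED in this file** (section `StableFormsProof`, no sorry) from the tree's `hypLaplacian_comp_smul`,
  `hypLaplacian_finset_sum`, `isC2_finset_sum`, `contDiffOn_smulExtend` and piece 2.
* `stub_heckeCosetPermutation` (= child `HeckeCosetPermutation`, support) — GROUP THEORY: right
  multiplication by `γ ∈ Γ₁(N)` permutes the `p + 1` cosets `Γ₁(N) M_j` (`M_b = (1 b; 0 p)`,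
  `M_p = σ·(p 0; 0 1)`): `M_j γ = δ_j M_{e j}`, `δ_j ∈ Γ₁(N)`, `e` a permutation (DS §5.2).
  **PROVED in this file** (section `CosetPermutationProof`, no sorry) from the tree's
  `HeckeTGamma1.existsUnique_option` / `exists_X` / `mem_gamma1_of_gamma0Map_eq_one`: `M_j = ε_j diag(1,p) t_j`
  with `ε_p = σ M⁻¹ ∈ Γ₁(N)`; cover by existence, injectivity of `j ↦ e j` by uniqueness.
* `stub_heckePeriodIntertwining` (= child `HeckePeriodIntertwining`, crux) — ANALYSIS OF PERIODS: the
  BLZ period cocycle INTERTWINES `T'_p` with the double-coset sum on two-point periods,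
  `r^{T'u}_γ(t) = Σ_j (∫_{M_j γ⁻¹ i}^{M_j i} [u, R(·;·)^{1/2}]) |_{M_j} (t)` off a finite set — linearity of
  `u ↦ ∫[u, R^s]` plus the pull-back law `∫_a^b[u∘g, R_t^s] = (det g)^s · (∫_{ga}^{gb}[u, R^s])|_{2s} g`
  (BLZ (2.25) + (1.10a)) for the integer matrices `M_j` of determinant `p`; THE place where the
  `√p` cancels (`p^{-1/2} · (det M_j)^{1/2} = 1`), i.e. where the planner's normalisation risk lives.
  **PROVED in this file** (section `PeriodLaws`, no sorry) from the tree's `greenPeriod_add`-type laws: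
  linearity `greenPeriod_finset_sum` and the pull-back law `greenPeriod_comp_smul` (proved here from
  `greenSegmentIntegral_comp_smul` / `hypPoissonKernelCpow_glSmul`), with the `√p` cancelled by the kernel.

ASSEMBLY (proved here): (i) the route's inlined `lzCocycle` IS the library's
`lewisZagierCocycle (1/2) I u (mapGL γ)` (`lzCocycleR_eq`: the real kernel `√(Im z)/|z - t|` and its real
Fréchet derivative versus `R(t;z)^{1/2}` and its Wirtinger derivative), the route's `slashHalf` IS
`lineSlash (1/2) (mapGL γ)`, `IsPRQ = IsPiecewiseRational ℚ` and `IsSemiAnalytic = IsSemiAnalyticVector`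
(`Iff.rfl`); (ii) given the rational-class data `(q, f)` of `u` and the permutation data of piece 2 at
`γ⁻¹`, unfold `∫_{δ M_k i}^{M_j i} = (∫_{M_k i}^{i})|δ⁻¹ + r^u_{δ⁻¹} + ∫_i^{M_j i}` (path additivity
`greenPeriod_add` and `Γ`-equivariance `lineSlash_greenPeriod`, tree), slash by `M_j`, use
`(φ|δ⁻¹)|M_j = (φ|M_k)|γ` and re-index by `e` (steps 1–3): `r^{T'u}_γ ≡ q'_γ + f'|γ - f'` with
`q'_γ := Σ_j q_{δ_j⁻¹} | M_j` and `f' := Σ_j f|M_j - Σ_j F_j|M_j`, `F_j = ∫_i^{M_j i}`; (iii) `q'_γ ∈ PR_ℚ`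
(`IsPiecewiseRational.slashHalf`: `PR_ℚ` is stable under the determinant-free slash of integer
matrices, tree), `f'` is semi-analytic (`isAnalyticVector_greenPeriod`, `IsSemiAnalyticVector.lineSlash`,
tree), and the cocycle law of `q'` follows from that of `r^{T'u}` (`lewisZagierCocycle_mul_cofinite`,
tree, applied to `T'u ∈ S(N)` = piece 1) by difference of cocycles.
STATUS (2026-08-17): NO `sorry` IN THIS FILE — all three pieces are proved here, so the registered
composition `HeckePreservesRationalPeriods_of : HeckePreservesRationalPeriods` (the route decl BY NAME) is a
COMPLETE PROOF OF THE CRUX (`lean check` rc 0, 0 sorries, axioms propext / Classical.choice / Quot.sound).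
The three `stub_*` keep their registered names and signatures (now theorems). To close the item a prover lands
this file's content under `Summits/Langlands/Langlands/Theorems/` (≤ 400-line parts; see the LANDING note
attached as evidence on stmt-Langlands-2807) — planners cannot propose to `Theorems/`.

References: Bruggeman–Lewis–Zagier, Mem. AMS 1118 (2015) (2.25), (5.4)–(5.5a) [BruggemanLewisZagier2015];
Diamond–Shurman GTM 228 Prop. 5.2.1 [DiamondShurman2005]; Mühlenbruch, J. Number Theory 118 (2006) 208–235
(Hecke operators on period functions) doi:10.1016/j.jnt.2005.09.003.
-/

noncomputable section

set_option linter.dupNamespace false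

open scoped MatrixGroups Topology ComplexConjugate
open Filter Set

namespace Summit.Langlands.Langlands.Cruxes.HeckePreservesRationalPeriods.Decomposition

open Literature.NumberTheory.Automorphic UpperHalfPlane
open Summit.Langlands.Langlands.Theses.RationalPeriodQuarter

/-- The route's `slashHalf` (verbatim). [folklore] -/
def slashHalfR : Matrix.SpecialLinearGroup (Fin 2) ℤ → (ℝ → ℂ) → ℝ → ℂ := fun g φ t => ((|((g : Matrix (Fin 2) (Fin 2) ℤ) 1 0 : ℝ) * t + ((g : Matrix (Fin 2) (Fin 2) ℤ) 1 1 : ℝ)|⁻¹ : ℝ) : ℂ) * φ ((((g : Matrix (Fin 2) (Fin 2) ℤ) 0 0 : ℝ) * t + ((g : Matrix (Fin 2) (Fin 2) ℤ) 0 1 : ℝ)) / (((g : Matrix (Fin 2) (Fin 2) ℤ) 1 0 : ℝ) * t + ((g : Matrix (Fin 2) (Fin 2) ℤ) 1 1 : ℝ)))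

/-- The route's `IsQuarterCuspForm` (verbatim). [folklore] -/
def IsQuarterCuspFormR : ℕ → (UpperHalfPlane → ℂ) → Prop := fun N u => Literature.NumberTheory.Automorphic.IsC2 u ∧ (∀ γ ∈ CongruenceSubgroup.Gamma1 N, ∀ z : UpperHalfPlane, u (γ • z) = u z) ∧ (∀ z : UpperHalfPlane, Literature.NumberTheory.Automorphic.hypLaplacian u z + (1 / 4 : ℂ) * u z = 0) ∧ ∃ C : ℝ, ∀ z : UpperHalfPlane, ‖u z‖ ≤ C

/-- The route's `lzCocycle` (verbatim). [cite: BruggemanLewisZagier2015, (5.4)–(5.5a)] -/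
def lzCocycleR : (UpperHalfPlane → ℂ) → Matrix.SpecialLinearGroup (Fin 2) ℤ → ℝ → ℂ := fun u γ t => ∫ τ in (0 : ℝ)..1, (let w : ℂ := (1 - (τ : ℂ)) * ((γ⁻¹ • UpperHalfPlane.I : UpperHalfPlane) : ℂ) + (τ : ℂ) * Complex.I; let dw : ℂ := Complex.I - ((γ⁻¹ • UpperHalfPlane.I : UpperHalfPlane) : ℂ); (fderiv ℝ (u ∘ UpperHalfPlane.ofComplex) w 1 - Complex.I * fderiv ℝ (u ∘ UpperHalfPlane.ofComplex) w Complex.I) / 2 * ((Real.sqrt w.im / ‖w - (t : ℂ)‖ : ℝ) : ℂ) * dw + (u ∘ UpperHalfPlane.ofComplex) w * (((fderiv ℝ (fun x : ℂ => Real.sqrt x.im / ‖x - (t : ℂ)‖) w 1 : ℝ) + Complex.I * (fderiv ℝ (fun x : ℂ => Real.sqrt x.im / ‖x - (t : ℂ)‖) w Complex.I : ℝ)) / 2) * (starRingEnd ℂ) dw)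

/-- The route's `IsPRQ` (verbatim). [folklore] -/
def IsPRQR : (ℝ → ℂ) → Prop := fun φ => ∃ F : Finset ℚ, (∀ a b : ℚ, a < b → (∀ r ∈ F, r ≤ a ∨ b ≤ r) → ∃ P Q : Polynomial ℚ, ∀ x : ℝ, (a : ℝ) < x → x < b → Polynomial.aeval (x : ℂ) Q ≠ 0 ∧ φ x = Polynomial.aeval (x : ℂ) P / Polynomial.aeval (x : ℂ) Q) ∧ ∃ B : ℚ, (∃ P Q : Polynomial ℚ, ∀ x : ℝ, (B : ℝ) < x → Polynomial.aeval (x : ℂ) Q ≠ 0 ∧ φ x = Polynomial.aeval (x : ℂ) P / Polynomial.aeval (x : ℂ) Q) ∧ (∃ P Q : Polynomial ℚ, ∀ x : ℝ, x < -(B : ℝ) → Polynomial.aeval (x : ℂ) Q ≠ 0 ∧ φ x = Polynomial.aeval (x : ℂ) P / Polynomial.aeval (x : ℂ) Q)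

/-- The route's `IsSemiAnalytic` (verbatim). [folklore] -/
def IsSemiAnalyticR : (ℝ → ℂ) → Prop := fun f => ∃ F : Finset ℝ, AnalyticOnNhd ℝ f ((↑F : Set ℝ)ᶜ)

/-- The route's `HasRationalPeriodClass` (verbatim, over the named helpers). [folklore] -/
def HasRationalPeriodClassR : ℕ → (UpperHalfPlane → ℂ) → Prop := fun N u => ∃ (q : Matrix.SpecialLinearGroup (Fin 2) ℤ → ℝ → ℂ) (f : ℝ → ℂ), (∀ γ ∈ CongruenceSubgroup.Gamma1 N, IsPRQR (q γ)) ∧ (∀ γ ∈ CongruenceSubgroup.Gamma1 N, ∀ δ ∈ CongruenceSubgroup.Gamma1 N, ∀ᶠ t in Filter.cofinite, q (γ * δ) t = slashHalfR δ (q γ) t + q δ t) ∧ IsSemiAnalyticR f ∧ ∀ γ ∈ CongruenceSubgroup.Gamma1 N, ∀ᶠ t in Filter.cofinite, lzCocycleR u γ t = q γ t + slashHalfR γ f t - f t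

/-- The crux, restated over the named helpers. [folklore] -/
def HeckePreservesRationalPeriodsR : Prop :=
  ∀ N : ℕ, 0 < N → ∀ p : ℕ, p.Prime → ¬ p ∣ N → ∀ σ ∈ CongruenceSubgroup.Gamma0 N, (((σ : Matrix (Fin 2) (Fin 2) ℤ) 1 1 : ℤ) : ZMod N) = (p : ZMod N) → ∀ u : UpperHalfPlane → ℂ, IsQuarterCuspFormR N u → HasRationalPeriodClassR N u → IsQuarterCuspFormR N (fun z : UpperHalfPlane => ((Real.sqrt p : ℝ) : ℂ)⁻¹ * (∑ b ∈ Finset.range p, u (UpperHalfPlane.ofComplex (((z : ℂ) + b) / p)) + u (σ • UpperHalfPlane.ofComplex ((p : ℂ) * (z : ℂ))))) ∧ HasRationalPeriodClassR N (fun z : UpperHalfPlane => ((Real.sqrt p : ℝ) : ℂ)⁻¹ * (∑ b ∈ Finset.range p, u (UpperHalfPlane.ofComplex (((z : ℂ) + b) / p)) + u (σ • UpperHalfPlane.ofComplex ((p : ℂ) * (z : ℂ)))))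

/-- The route decl unfolds to the restatement over the named helpers (definitional). [folklore] -/
theorem heckePreservesRationalPeriods_iff :
    HeckePreservesRationalPeriods ↔ HeckePreservesRationalPeriodsR := Iff.rfl

/-! ## Bridges -/

theorem isPRQR_iff (φ : ℝ → ℂ) : IsPRQR φ ↔ IsPiecewiseRational ℚ φ := Iff.rfl

/-- The route's semi-analyticity is the library's `IsSemiAnalyticVector` (definitional). [folklore] -/
theorem isSemiAnalyticR_iff (f : ℝ → ℂ) : IsSemiAnalyticR f ↔ IsSemiAnalyticVector f := Iff.rfl

/-- The route's `slashHalf` on `SL₂(ℤ)` is the library's determinant-free `slashHalf` of the underlying integer matrix. [folklore] -/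
theorem slashHalfR_eq (g : SL(2, ℤ)) (φ : ℝ → ℂ) (t : ℝ) :
    slashHalfR g φ t = Literature.NumberTheory.Automorphic.slashHalf (g : Matrix (Fin 2) (Fin 2) ℤ) φ t := rfl

/-- The route's `slashHalf` is the line-model slash `lineSlash (1/2)` by `mapGL γ`. [folklore] -/
theorem slashHalfR_eq_lineSlash (g : SL(2, ℤ)) (φ : ℝ → ℂ) (t : ℝ) :
    slashHalfR g φ t = lineSlash (1 / 2) (Matrix.SpecialLinearGroup.mapGL ℝ g) φ t := by
  rw [lineSlash_mapGL_one_half]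
  rfl

/-- The `SL₂(ℤ)`-action on `ℍ` factors through `mapGL` (definitional). [folklore] -/
theorem sl_smul_eq_mapGL_smul (γ : SL(2, ℤ)) (z : ℍ) :
    γ • z = (Matrix.SpecialLinearGroup.mapGL ℝ γ) • z := rfl


/-! ### The period cocycle: route integrand = library Green's form -/

/-- The real kernel used by the route: `f_t(x) = √(Im x) / |x - t|`. [folklore] -/
def routeKernel (t : ℝ) (x : ℂ) : ℝ := Real.sqrt x.im / ‖x - (t : ℂ)‖

/-- The real kernel `√(Im x)/|x - t|` is real-differentiable on the upper half-plane. [folklore] -/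
theorem differentiableAt_routeKernel (t : ℝ) {w : ℂ} (hw : 0 < w.im) :
    DifferentiableAt ℝ (routeKernel t) w := by
  unfold routeKernel
  have him : DifferentiableAt ℝ (fun x : ℂ => x.im) w := Complex.imCLM.differentiableAt
  have hsqrt : DifferentiableAt ℝ (fun x : ℂ => Real.sqrt x.im) w := him.sqrt hw.ne'
  have hsub : DifferentiableAt ℝ (fun x : ℂ => x - (t : ℂ)) w := differentiableAt_id.sub_const _
  have hne : w - (t : ℂ) ≠ 0 := by
    intro h
    have := congrArg Complex.im h
    simp at this
    exact hw.ne' this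
  have hnorm : DifferentiableAt ℝ (fun x : ℂ => ‖x - (t : ℂ)‖) w := DifferentiableAt.norm ℝ hsub hne
  have hinv : DifferentiableAt ℝ (fun x : ℂ => (‖x - (t : ℂ)‖)⁻¹) w := hnorm.inv (norm_ne_zero_iff.mpr hne)
  have h := hsqrt.mul hinv
  have e : (fun x : ℂ => Real.sqrt x.im / ‖x - (t : ℂ)‖) = fun x => Real.sqrt x.im * (‖x - (t : ℂ)‖)⁻¹ := by
    funext x; rw [div_eq_mul_inv]
  rw [e]; exact h

/-- Near a point of `ℍ`, the library kernel `R(t;·)^{1/2}` is the real kernel cast to `ℂ`. [folklore] -/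
theorem hypPoissonKernelCpow_half_eventuallyEq (t : ℝ) {w : ℂ} (hw : 0 < w.im) :
    hypPoissonKernelCpow (1 / 2) t =ᶠ[𝓝 w] fun x => ((routeKernel t x : ℝ) : ℂ) := by
  filter_upwards [isOpen_upperHalfPlaneSet.mem_nhds hw] with x hx
  exact hypPoissonKernelCpow_one_half (le_of_lt hx)

/-- Hence their real Fréchet derivatives agree on `ℍ` (cast to `ℂ`). [folklore] -/
theorem fderiv_hypPoissonKernelCpow_half (t : ℝ) {w : ℂ} (hw : 0 < w.im) (v : ℂ) :
    fderiv ℝ (hypPoissonKernelCpow (1 / 2) t) w v = ((fderiv ℝ (routeKernel t) w v : ℝ) : ℂ) := by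
  rw [(hypPoissonKernelCpow_half_eventuallyEq t hw).fderiv_eq]
  have h := (Complex.ofRealCLM.hasFDerivAt.comp w (differentiableAt_routeKernel t hw).hasFDerivAt)
  rw [show (fun x => ((routeKernel t x : ℝ) : ℂ)) = (⇑Complex.ofRealCLM ∘ routeKernel t) from rfl, h.fderiv]
  simp

/-- **Bridge.** The route's inlined period cocycle IS the library's `lewisZagierCocycle (1/2) I u (mapGL γ)`:
same segment `[γ⁻¹ i, i]`, same Green's form once the real kernel and its derivative are identified with
`R(t;·)^{1/2}` and its Wirtinger derivatives. [cite: BruggemanLewisZagier2015, (5.4)–(5.5a)] -/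
theorem lzCocycleR_eq (u : ℍ → ℂ) (γ : SL(2, ℤ)) (t : ℝ) :
    lzCocycleR u γ t =
      lewisZagierCocycle (1 / 2) UpperHalfPlane.I u (Matrix.SpecialLinearGroup.mapGL ℝ γ) t := by
  have hγ : ((Matrix.SpecialLinearGroup.mapGL ℝ γ)⁻¹ • UpperHalfPlane.I : ℍ) = γ⁻¹ • UpperHalfPlane.I := by
    rw [← map_inv]; rfl
  rw [lewisZagierCocycle_apply, hγ, UpperHalfPlane.coe_I]
  unfold lzCocycleR
  refine intervalIntegral.integral_congr fun τ hτ => ?_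
  rw [uIcc_of_le zero_le_one] at hτ
  set a : ℂ := ((γ⁻¹ • UpperHalfPlane.I : ℍ) : ℂ) with ha
  have ha_im : 0 < a.im := (γ⁻¹ • UpperHalfPlane.I).im_pos
  set w : ℂ := (1 - (τ : ℂ)) * a + (τ : ℂ) * Complex.I with hw_def
  have hw : 0 < w.im := by
    simp only [hw_def, Complex.add_im, Complex.mul_im, Complex.sub_re, Complex.one_re, Complex.ofReal_re,
      Complex.sub_im, Complex.one_im, Complex.ofReal_im, sub_zero, zero_mul, add_zero, Complex.I_re,
      Complex.I_im, mul_zero, mul_one]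
    rcases eq_or_lt_of_le hτ.1 with h0 | h0
    · rw [← h0]; simpa using ha_im
    · have : 0 ≤ 1 - τ := by linarith [hτ.2]
      nlinarith [mul_nonneg this ha_im.le]
  have hV : hypPoissonKernelCpow (1 / 2) t w = ((routeKernel t w : ℝ) : ℂ) :=
    hypPoissonKernelCpow_one_half hw.le
  simp only []
  show _ = greenForm (u ∘ UpperHalfPlane.ofComplex) (hypPoissonKernelCpow (1 / 2) t) w (Complex.I - a)
  unfold greenForm wirtingerDz wirtingerDzbar
  rw [hV, fderiv_hypPoissonKernelCpow_half t hw 1, fderiv_hypPoissonKernelCpow_half t hw Complex.I]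
  rfl

/-! ## The pieces (children of the split) -/

/-- piece 1 (crux): HECKE STABILITY OF THE QUARTER CUSP FORMS. [cite: DiamondShurman2005, Prop. 5.2.1] -/
def HeckeStableQuarterForms : Prop :=
  let IsQuarterCuspForm : ℕ → (UpperHalfPlane → ℂ) → Prop := fun N u => Literature.NumberTheory.Automorphic.IsC2 u ∧ (∀ γ ∈ CongruenceSubgroup.Gamma1 N, ∀ z : UpperHalfPlane, u (γ • z) = u z) ∧ (∀ z : UpperHalfPlane, Literature.NumberTheory.Automorphic.hypLaplacian u z + (1 / 4 : ℂ) * u z = 0) ∧ ∃ C : ℝ, ∀ z : UpperHalfPlane, ‖u z‖ ≤ C; ∀ N : ℕ, 0 < N → ∀ p : ℕ, p.Prime → ¬ p ∣ N → ∀ σ ∈ CongruenceSubgroup.Gamma0 N, (((σ : Matrix (Fin 2) (Fin 2) ℤ) 1 1 : ℤ) : ZMod N) = (p : ZMod N) → ∀ u : UpperHalfPlane → ℂ, IsQuarterCuspForm N u → IsQuarterCuspForm N (fun z : UpperHalfPlane => ((Real.sqrt p : ℝ) : ℂ)⁻¹ * (∑ b ∈ Finset.range p, u (UpperHalfPlane.ofComplex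 (((z : ℂ) + b) / p)) + u (σ • UpperHalfPlane.ofComplex ((p : ℂ) * (z : ℂ)))))

/-- piece 2 (support): THE COSET PERMUTATION of the `p + 1` Hecke matrices under `Γ₁(N)`. [cite: DiamondShurman2005, §5.2] -/
def HeckeCosetPermutation : Prop :=
  ∀ N : ℕ, 0 < N → ∀ p : ℕ, p.Prime → ¬ p ∣ N → ∀ σ ∈ CongruenceSubgroup.Gamma0 N, (((σ : Matrix (Fin 2) (Fin 2) ℤ) 1 1 : ℤ) : ZMod N) = (p : ZMod N) → let M : Fin (p + 1) → Matrix (Fin 2) (Fin 2) ℤ := (fun j : Fin (p + 1) => if (j : ℕ) < p then !![(1 : ℤ), ((j : ℕ) : ℤ); 0, (p : ℤ)] else (σ : Matrix (Fin 2) (Fin 2) ℤ) * !![(p : ℤ), 0; 0, 1]); ∀ γ ∈ CongruenceSubgroup.Gamma1 N, ∃ (e : Equiv.Perm (Fin (p + 1))) (δ : Fin (p + 1) → Matrix.SpecialLinearGroup (Fin 2) ℤ), ∀ j : Fin (p + 1), δ j ∈ CongruenceSubgroup.Gamma1 N ∧ M j * (γ : Matrix (Fin 2) (Fin 2) ℤ)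 = (δ j : Matrix (Fin 2) (Fin 2) ℤ) * M (e j)

/-- piece 3 (crux): PERIOD INTERTWINING (linearity + BLZ (2.25) pull-back law of the period
integral under the Hecke matrices). [cite: BruggemanLewisZagier2015, (2.25)] -/
def HeckePeriodIntertwining : Prop :=
  let IsQuarterCuspForm : ℕ → (UpperHalfPlane → ℂ) → Prop := fun N u => Literature.NumberTheory.Automorphic.IsC2 u ∧ (∀ γ ∈ CongruenceSubgroup.Gamma1 N, ∀ z : UpperHalfPlane, u (γ • z) = u z) ∧ (∀ z : UpperHalfPlane, Literature.NumberTheory.Automorphic.hypLaplacian u z + (1 / 4 : ℂ) * u z = 0) ∧ ∃ C : ℝ, ∀ z : UpperHalfPlane, ‖u z‖ ≤ C; ∀ N : ℕ, 0 < N → ∀ p : ℕ, p.Prime → ¬ p ∣ N → ∀ σ ∈ CongruenceSubgroup.Gamma0 N, (((σ : Matrix (Fin 2) (Fin 2) ℤ) 1 1 : ℤ) : ZMod N) = (p : ZMod N) → let M : Fin (p + 1) → Matrix (Fin 2) (Fin 2) ℤ := (fun j : Fin (p + 1) => if (j : ℕ) < p then !![(1 : ℤ), ((j : ℕ) : ℤ);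 0, (p : ℤ)] else (σ : Matrix (Fin 2) (Fin 2) ℤ) * !![(p : ℤ), 0; 0, 1]); let A : Fin (p + 1) → UpperHalfPlane → UpperHalfPlane := (fun (j : Fin (p + 1)) (z : UpperHalfPlane) => if (j : ℕ) < p then UpperHalfPlane.ofComplex (((z : ℂ) + ((j : ℕ) : ℂ)) / (p : ℂ)) else σ • UpperHalfPlane.ofComplex ((p : ℂ) * (z : ℂ))); ∀ u : UpperHalfPlane → ℂ, IsQuarterCuspForm N u → ∀ γ : Matrix.SpecialLinearGroup (Fin 2) ℤ, ∀ᶠ t in Filter.cofinite, Literature.NumberTheory.Automorphic.lewisZagierCocycle (1 / 2) UpperHalfPlane.I (fun z : UpperHalfPlane => ((Real.sqrt p : ℝ) : ℂ)⁻¹ * (∑ b ∈ Finset.range p, u (UpperHalfPlane.ofComplex (((z : ℂ) + b) / p)) + u (σ • UpperHalfPlane.ofComplex ((p : ℂ) * (z : ℂ))))) (Matrix.SpecialLinearGroup.mapGL ℝ γ) t = ∑ j : Fin (p + 1), Literature.NumberTheory.Automorphic.slashHalf (M j) (Literature.NumberTheory.Automorphic.greenPeriod (1 / 2) u (A j (γ⁻¹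 • UpperHalfPlane.I)) (A j UpperHalfPlane.I)) t

/-- glue item: the three pieces imply the crux. [folklore] -/
def HeckePreservesRationalPeriodsOfSubs : Prop :=
  HeckeStableQuarterForms → HeckeCosetPermutation → HeckePeriodIntertwining → HeckePreservesRationalPeriods

/-! ## Named forms of the inlined helpers of the pieces -/

/-- The `p + 1` integer Hecke matrices `M_j = (1 j; 0 p)` (`j < p`), `M_p = σ · (p 0; 0 1)`. [cite: DiamondShurman2005, Prop. 5.2.1] -/
def heckeMat (p : ℕ) (σ : SL(2, ℤ)) : Fin (p + 1) → Matrix (Fin 2) (Fin 2) ℤ := (fun j : Fin (p + 1) => if (j : ℕ) < p then !![(1 : ℤ), ((j : ℕ) : ℤ); 0, (p : ℤ)] else (σ : Matrix (Fin 2) (Fin 2) ℤ) * !![(p : ℤ), 0; 0, 1])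

/-- Their action on `ℍ` as written in the route's `T'_p`. [folklore] -/
def heckeAct (p : ℕ) (σ : SL(2, ℤ)) : Fin (p + 1) → UpperHalfPlane → UpperHalfPlane := (fun (j : Fin (p + 1)) (z : UpperHalfPlane) => if (j : ℕ) < p then UpperHalfPlane.ofComplex (((z : ℂ) + ((j : ℕ) : ℂ)) / (p : ℂ)) else σ • UpperHalfPlane.ofComplex ((p : ℂ) * (z : ℂ)))

/-- The route's normalised Hecke operator `T'_p = p^(-1/2) T_p` (verbatim). [folklore] -/
def heckeT (p : ℕ) (σ : SL(2, ℤ)) (u : UpperHalfPlane → ℂ) : UpperHalfPlane → ℂ := (fun z : UpperHalfPlane => ((Real.sqrt p : ℝ) : ℂ)⁻¹ * (∑ b ∈ Finset.range p, u (UpperHalfPlane.ofComplex (((z : ℂ) + b) / p)) + u (σ • UpperHalfPlane.ofComplex ((p : ℂ) * (z : ℂ)))))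

/-- Piece 1 over the named helpers (definitional). [folklore] -/
theorem heckeStableQuarterForms_iff : HeckeStableQuarterForms ↔
    ∀ N : ℕ, 0 < N → ∀ p : ℕ, p.Prime → ¬ p ∣ N → ∀ σ ∈ CongruenceSubgroup.Gamma0 N,
      (((σ : Matrix (Fin 2) (Fin 2) ℤ) 1 1 : ℤ) : ZMod N) = (p : ZMod N) → ∀ u : UpperHalfPlane → ℂ,
        IsQuarterCuspFormR N u → IsQuarterCuspFormR N (heckeT p σ u) := Iff.rfl

/-- Piece 2 over the named helpers (definitional). [folklore] -/
theorem heckeCosetPermutation_iff : HeckeCosetPermutation ↔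
    ∀ N : ℕ, 0 < N → ∀ p : ℕ, p.Prime → ¬ p ∣ N → ∀ σ ∈ CongruenceSubgroup.Gamma0 N,
      (((σ : Matrix (Fin 2) (Fin 2) ℤ) 1 1 : ℤ) : ZMod N) = (p : ZMod N) →
      ∀ γ ∈ CongruenceSubgroup.Gamma1 N, ∃ (e : Equiv.Perm (Fin (p + 1)))
        (δ : Fin (p + 1) → SL(2, ℤ)), ∀ j : Fin (p + 1), δ j ∈ CongruenceSubgroup.Gamma1 N ∧
          heckeMat p σ j * (γ : Matrix (Fin 2) (Fin 2) ℤ) = (δ j : Matrix (Fin 2) (Fin 2) ℤ) * heckeMat p σ (e j) :=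
  Iff.rfl

/-- Piece 3 over the named helpers (definitional). [folklore] -/
theorem heckePeriodIntertwining_iff : HeckePeriodIntertwining ↔
    ∀ N : ℕ, 0 < N → ∀ p : ℕ, p.Prime → ¬ p ∣ N → ∀ σ ∈ CongruenceSubgroup.Gamma0 N,
      (((σ : Matrix (Fin 2) (Fin 2) ℤ) 1 1 : ℤ) : ZMod N) = (p : ZMod N) →
      ∀ u : UpperHalfPlane → ℂ, IsQuarterCuspFormR N u → ∀ γ : SL(2, ℤ), ∀ᶠ t in cofinite,
        lewisZagierCocycle (1 / 2) UpperHalfPlane.I (heckeT p σ u) (Matrix.SpecialLinearGroup.mapGL ℝ γ) t =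
          ∑ j : Fin (p + 1), Literature.NumberTheory.Automorphic.slashHalf (heckeMat p σ j)
            (greenPeriod (1 / 2) u (heckeAct p σ j (γ⁻¹ • UpperHalfPlane.I)) (heckeAct p σ j UpperHalfPlane.I)) t :=
  Iff.rfl

/-! ## The Hecke matrices as elements of `GL₂(ℝ)⁺` -/

section HeckeGL

variable (p : ℕ) (σ : SL(2, ℤ))

/-- An integer matrix of non-zero determinant as an element of `GL₂(ℝ)`. -/
theorem map_intCast_mul (A B : Matrix (Fin 2) (Fin 2) ℤ) :
    (A * B).map (Int.cast : ℤ → ℝ) = A.map (Int.cast : ℤ → ℝ) * B.map (Int.cast : ℤ → ℝ) := by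
  ext i j
  simp [Matrix.mul_apply, Fin.sum_univ_two]

/-- `det` commutes with the cast `ℤ → ℝ` of a `2 × 2` matrix. [folklore] -/
theorem det_map_intCast (M : Matrix (Fin 2) (Fin 2) ℤ) :
    (M.map (Int.cast : ℤ → ℝ)).det = ((M.det : ℤ) : ℝ) := by
  rw [show M.map (Int.cast : ℤ → ℝ) = (Int.castRingHom ℝ).mapMatrix M from rfl, ← RingHom.map_det]
  simp

/-- An integer matrix of non-zero determinant as an element of `GL₂(ℝ)`. [folklore] -/
def glOfDet (M : Matrix (Fin 2) (Fin 2) ℤ) (h : M.det ≠ 0) : GL (Fin 2) ℝ :=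
  Matrix.GeneralLinearGroup.mkOfDetNeZero (M.map (Int.cast : ℤ → ℝ)) (by
    rw [det_map_intCast]; exact_mod_cast h)

/-- Entries of `glOfDet`. [folklore] -/
@[simp] theorem glOfDet_apply (M : Matrix (Fin 2) (Fin 2) ℤ) (h : M.det ≠ 0) (i j : Fin 2) :
    (glOfDet M h) i j = ((M i j : ℤ) : ℝ) := rfl

/-- Underlying matrix of `glOfDet`. [folklore] -/
theorem glOfDet_coe (M : Matrix (Fin 2) (Fin 2) ℤ) (h : M.det ≠ 0) :
    ((glOfDet M h : GL (Fin 2) ℝ) : Matrix (Fin 2) (Fin 2) ℝ) = M.map (Int.cast : ℤ → ℝ) := rfl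

/-- Determinant of `glOfDet`. [folklore] -/
theorem glOfDet_det (M : Matrix (Fin 2) (Fin 2) ℤ) (h : M.det ≠ 0) :
    (glOfDet M h).det.val = ((M.det : ℤ) : ℝ) := by
  rw [Matrix.GeneralLinearGroup.val_det_apply, glOfDet_coe, det_map_intCast]

variable {p} in
/-- Every Hecke matrix `M_j` has determinant `p`. [folklore] -/
theorem heckeMat_det (_hp : p.Prime) (j : Fin (p + 1)) : (heckeMat p σ j).det = p := by
  unfold heckeMat
  split_ifs with hj
  · simp [Matrix.det_fin_two_of]
  · rw [Matrix.det_mul, σ.det_coe, Matrix.det_fin_two_of]; ring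

variable {p} in
/-- … hence non-zero determinant. [folklore] -/
theorem heckeMat_det_ne_zero (hp : p.Prime) (j : Fin (p + 1)) : (heckeMat p σ j).det ≠ 0 := by
  rw [heckeMat_det σ hp j]; exact_mod_cast hp.ne_zero

variable {p} in
/-- The Hecke matrices in `GL₂(ℝ)`. [folklore] -/
def heckeGL (hp : p.Prime) (j : Fin (p + 1)) : GL (Fin 2) ℝ :=
  glOfDet (heckeMat p σ j) (heckeMat_det_ne_zero σ hp j)

variable {p} in
/-- The Hecke matrices lie in `GL₂(ℝ)⁺`. [folklore] -/
theorem heckeGL_det_pos (hp : p.Prime) (j : Fin (p + 1)) : 0 < (heckeGL σ hp j).det.val := by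
  unfold heckeGL; rw [glOfDet_det, heckeMat_det σ hp j]; exact_mod_cast hp.pos

variable {p} in
/-- Entries of `heckeGL`. [folklore] -/
theorem heckeGL_apply (hp : p.Prime) (j : Fin (p + 1)) (i k : Fin 2) :
    (heckeGL σ hp j) i k = ((heckeMat p σ j i k : ℤ) : ℝ) := rfl

/-- The route's `slashHalf` by an integer matrix is the line-model slash at `s = 1/2` by the
corresponding element of `GL₂(ℝ)` (same junk value `0` at the pole). -/
theorem slashHalf_eq_lineSlash (M : Matrix (Fin 2) (Fin 2) ℤ) (h : M.det ≠ 0) (φ : ℝ → ℂ) (t : ℝ) :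
    Literature.NumberTheory.Automorphic.slashHalf M φ t = lineSlash (1 / 2) (glOfDet M h) φ t := by
  rw [lineSlash_one_half]
  rfl

/-- The matrix of `mapGL γ` is the entrywise cast of `γ`. [folklore] -/
theorem mapGL_coe_eq_map (γ : SL(2, ℤ)) :
    ((Matrix.SpecialLinearGroup.mapGL ℝ γ : GL (Fin 2) ℝ) : Matrix (Fin 2) (Fin 2) ℝ) =
      (γ : Matrix (Fin 2) (Fin 2) ℤ).map (Int.cast : ℤ → ℝ) := by
  ext i j
  rw [Matrix.map_apply]
  exact mapGL_real_apply γ i j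

variable {p} in
/-- Transport of an integer matrix identity `M_j γ = δ M_k` to `GL₂(ℝ)`. -/
theorem heckeGL_mul_eq (hp : p.Prime) {j k : Fin (p + 1)} {γ δ : SL(2, ℤ)}
    (h : heckeMat p σ j * (γ : Matrix (Fin 2) (Fin 2) ℤ) = (δ : Matrix (Fin 2) (Fin 2) ℤ) * heckeMat p σ k) :
    heckeGL σ hp j * Matrix.SpecialLinearGroup.mapGL ℝ γ =
      Matrix.SpecialLinearGroup.mapGL ℝ δ * heckeGL σ hp k := by
  apply Units.ext
  simp only [Units.val_mul, heckeGL, glOfDet_coe, mapGL_coe_eq_map, ← map_intCast_mul, h]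

variable {p} in
/-- The route's action of the `j`-th Hecke matrix is the Möbius action of `heckeGL j`. -/
theorem heckeAct_eq_smul (hp : p.Prime) (j : Fin (p + 1)) (z : ℍ) :
    heckeAct p σ j z = heckeGL σ hp j • z := by
  have hp0 : (0 : ℝ) < p := by exact_mod_cast hp.pos
  unfold heckeAct
  by_cases hj : (j : ℕ) < p
  · rw [if_pos hj]
    have him : 0 < ((((z : ℂ) + ((j : ℕ) : ℂ)) / (p : ℂ))).im := by
      rw [Complex.div_natCast_im]
      simp only [Complex.add_im, UpperHalfPlane.coe_im, Complex.natCast_im, add_zero]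
      exact div_pos z.im_pos hp0
    apply UpperHalfPlane.ext
    rw [UpperHalfPlane.ofComplex_apply_of_im_pos him, UpperHalfPlane.coe_smul_of_det_pos (heckeGL_det_pos σ hp j)]
    simp only [UpperHalfPlane.num, UpperHalfPlane.denom, heckeGL, glOfDet_coe, heckeMat, if_pos hj,
      Matrix.map_apply, Matrix.of_apply, Matrix.cons_val', Matrix.cons_val_zero, Matrix.cons_val_one,
      Matrix.empty_val', Matrix.cons_val_fin_one, Int.cast_one, Int.cast_natCast, Int.cast_zero,
      Complex.ofReal_one, Complex.ofReal_natCast, Complex.ofReal_zero, one_mul, zero_mul, zero_add]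
  · rw [if_neg hj]
    have him : 0 < ((p : ℂ) * (z : ℂ)).im := by
      simp only [Complex.mul_im, Complex.natCast_re, UpperHalfPlane.coe_im, Complex.natCast_im,
        UpperHalfPlane.coe_re, zero_mul, add_zero]
      exact mul_pos hp0 z.im_pos
    have hdetD : (!![(p : ℤ), 0; 0, 1] : Matrix (Fin 2) (Fin 2) ℤ).det ≠ 0 := by
      simp [Matrix.det_fin_two_of]; exact_mod_cast hp.ne_zero
    have hD : glOfDet (!![(p : ℤ), 0; 0, 1]) hdetD • z = UpperHalfPlane.ofComplex ((p : ℂ) * (z : ℂ)) := by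
      apply UpperHalfPlane.ext
      rw [UpperHalfPlane.ofComplex_apply_of_im_pos him, UpperHalfPlane.coe_smul_of_det_pos (by
        rw [glOfDet_det]; simp [Matrix.det_fin_two_of]; exact_mod_cast hp.pos)]
      simp [UpperHalfPlane.num, UpperHalfPlane.denom]
    have hsplit : heckeGL σ hp j = Matrix.SpecialLinearGroup.mapGL ℝ σ * glOfDet (!![(p : ℤ), 0; 0, 1]) hdetD := by
      apply Units.ext
      simp only [Units.val_mul, heckeGL, glOfDet_coe, mapGL_coe_eq_map, ← map_intCast_mul, heckeMat, if_neg hj]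
    rw [hsplit, mul_smul, hD]
    rfl

end HeckeGL

/-! ## Quarter cusp forms are invariant eigenfunctions at `s = 1/2` -/

section Quarter

/-- `Γ₁(N)` inside `GL₂(ℝ)`. -/
abbrev Gamma1GL (N : ℕ) : Subgroup (GL (Fin 2) ℝ) :=
  (CongruenceSubgroup.Gamma1 N).map (Matrix.SpecialLinearGroup.mapGL ℝ)

/-- `mapGL` sends `Γ₁(N)` into its image subgroup `Gamma1GL N ≤ GL₂(ℝ)`. [folklore] -/
theorem mapGL_mem_Gamma1GL {N : ℕ} {γ : SL(2, ℤ)} (hγ : γ ∈ CongruenceSubgroup.Gamma1 N) :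
    Matrix.SpecialLinearGroup.mapGL ℝ γ ∈ Gamma1GL N :=
  Subgroup.mem_map_of_mem _ hγ

/-- A quarter cusp form on `Γ₁(N)` is a `Gamma1GL N`-invariant eigenfunction with spectral parameter `s = 1/2`
(`s(1-s) = 1/4`), in the library's sense. [folklore] -/
theorem isInvariantEigenfunction_of_isQuarterCuspFormR {N : ℕ} {u : ℍ → ℂ}
    (hu : IsQuarterCuspFormR N u) : IsInvariantEigenfunction (Gamma1GL N) (1 / 2) u := by
  refine ⟨hu.1, fun z => ?_, ?_⟩
  · have h := hu.2.2.1 z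
    rw [← h]; norm_num
  · rintro _ ⟨γ, hγ, rfl⟩ z
    exact hu.2.1 γ hγ z

/-- `1/2 ≠ 0` in `ℂ`. [folklore] -/
theorem one_half_ne_zero' : (1 / 2 : ℂ) ≠ 0 := by norm_num
/-- `1/2 ≠ 1` in `ℂ`. [folklore] -/
theorem one_half_ne_one' : (1 / 2 : ℂ) ≠ 1 := by norm_num

end Quarter

/-! ## Line-model bookkeeping: slash of finite sums, cofinite identities -/

section LineBookkeeping

/-- The line-model slash of a finite sum. [folklore] -/
theorem lineSlash_finset_sum {ι : Type*} (S : Finset ι) (s : ℂ) (g : GL (Fin 2) ℝ) (φ : ι → ℝ → ℂ) (t : ℝ) :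
    lineSlash s g (fun x => ∑ i ∈ S, φ i x) t = ∑ i ∈ S, lineSlash s g (φ i) t := by
  simp only [lineSlash_apply, Finset.mul_sum]

/-- The line-model slash of a difference. [folklore] -/
theorem lineSlash_sub_apply (s : ℂ) (g : GL (Fin 2) ℝ) (φ ψ : ℝ → ℂ) (t : ℝ) :
    lineSlash s g (fun x => φ x - ψ x) t = lineSlash s g φ t - lineSlash s g ψ t := by
  simp only [lineSlash_apply, mul_sub]

/-- The line-model slash of a sum. [folklore] -/
theorem lineSlash_add_apply (s : ℂ) (g : GL (Fin 2) ℝ) (φ ψ : ℝ → ℂ) (t : ℝ) :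
    lineSlash s g (fun x => φ x + ψ x) t = lineSlash s g φ t + lineSlash s g ψ t := by
  simp only [lineSlash_apply, mul_add]

/-- The line-model slash of a negation. [folklore] -/
theorem lineSlash_neg_apply (s : ℂ) (g : GL (Fin 2) ℝ) (φ : ℝ → ℂ) (t : ℝ) :
    lineSlash s g (fun x => -φ x) t = -lineSlash s g φ t := by
  simp only [lineSlash_apply, mul_neg]

/-- The line-model slash commutes with scalars. [folklore] -/
theorem lineSlash_const_mul_apply (s : ℂ) (g : GL (Fin 2) ℝ) (c : ℂ) (φ : ℝ → ℂ) (t : ℝ) :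
    lineSlash s g (fun x => c * φ x) t = c * lineSlash s g φ t := by
  simp only [lineSlash_apply]; ring

/-- Cofinite congruence of the slash (pointwise-hypothesis form). -/
theorem lineSlash_congr_cofinite' (s : ℂ) (g : GL (Fin 2) ℝ) {φ φ' : ℝ → ℂ}
    (h : ∀ᶠ t in cofinite, φ t = φ' t) :
    ∀ᶠ t in cofinite, lineSlash s g φ t = lineSlash s g φ' t :=
  lineSlash_congr_cofinite s g h

end LineBookkeeping

/-! ## The main computation: the Hecke operator on period cocycles -/

section Main

variable {N p : ℕ} (hp : p.Prime) (σ : SL(2, ℤ)) {u : ℍ → ℂ} (hu : IsQuarterCuspFormR N u)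

/-- The base-point corrections `F_j = ∫_I^{M_j I} [u, R(t;·)^{1/2}]`. [folklore] -/
def baseCorr (j : Fin (p + 1)) : ℝ → ℂ :=
  greenPeriod (1 / 2) u UpperHalfPlane.I (heckeGL σ hp j • UpperHalfPlane.I)

include hu in
/-- The base-point corrections are semi-analytic (indeed analytic: `isAnalyticVector_greenPeriod`). [folklore] -/
theorem isSemiAnalyticVector_baseCorr (j : Fin (p + 1)) : IsSemiAnalyticVector (baseCorr hp σ (u := u) j) :=
  (isAnalyticVector_greenPeriod (1 / 2) hu.1 _ _).isSemiAnalyticVector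

/-- `(mapGL δ⁻¹)⁻¹ = mapGL δ`. [folklore] -/
theorem mapGL_inv_inv (δ : SL(2, ℤ)) :
    (Matrix.SpecialLinearGroup.mapGL ℝ δ⁻¹)⁻¹ = Matrix.SpecialLinearGroup.mapGL ℝ δ := by
  rw [map_inv, inv_inv]

include hu in
/-- Step 1 (pointwise, off the pole of `δ⁻¹`): unfolding `∫_{M_j γ⁻¹ I}^{M_j I}` along
`M_j γ⁻¹ = δ M_k` by path additivity and `Γ`-equivariance. -/
theorem step1 {γ δ : SL(2, ℤ)} (hδ : δ ∈ CongruenceSubgroup.Gamma1 N) {j k : Fin (p + 1)}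
    (h : heckeMat p σ j * ((γ⁻¹ : SL(2, ℤ)) : Matrix (Fin 2) (Fin 2) ℤ) =
      (δ : Matrix (Fin 2) (Fin 2) ℤ) * heckeMat p σ k)
    {t : ℝ} (ht : (Matrix.SpecialLinearGroup.mapGL ℝ δ⁻¹) 1 0 * t +
      (Matrix.SpecialLinearGroup.mapGL ℝ δ⁻¹) 1 1 ≠ 0) :
    greenPeriod (1 / 2) u (heckeGL σ hp j • (γ⁻¹ • UpperHalfPlane.I)) (heckeGL σ hp j • UpperHalfPlane.I) t =
      -(lineSlash (1 / 2) (Matrix.SpecialLinearGroup.mapGL ℝ δ⁻¹) (baseCorr hp σ (u := u) k) t) +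
        lewisZagierCocycle (1 / 2) UpperHalfPlane.I u (Matrix.SpecialLinearGroup.mapGL ℝ δ⁻¹) t +
        baseCorr hp σ (u := u) j t := by
  have hue := isInvariantEigenfunction_of_isQuarterCuspFormR hu
  set I := UpperHalfPlane.I
  set Mj := heckeGL σ hp j
  set Mk := heckeGL σ hp k
  set D := Matrix.SpecialLinearGroup.mapGL ℝ δ with hD
  -- the endpoint `M_j γ⁻¹ I = δ M_k I`
  have e1 : Mj • (γ⁻¹ • I) = D • (Mk • I) := by
    rw [sl_smul_eq_mapGL_smul, ← mul_smul, heckeGL_mul_eq σ hp h, mul_smul]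
  rw [e1]
  -- path additivity: `∫_{δ M_k I}^{M_j I} = ∫_{δ M_k I}^{δ I} + ∫_{δ I}^{I} + ∫_I^{M_j I}`
  have add1 := greenPeriod_add hue one_half_ne_zero' one_half_ne_one' t (D • (Mk • I)) (D • I) (Mj • I)
  have add2 := greenPeriod_add hue one_half_ne_zero' one_half_ne_one' t (D • I) I (Mj • I)
  rw [← add1, ← add2]
  -- first term: `Γ`-equivariance
  have hDinv : Matrix.SpecialLinearGroup.mapGL ℝ δ⁻¹ ∈ Gamma1GL N := mapGL_mem_Gamma1GL (inv_mem hδ)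
  have t1 := lineSlash_greenPeriod hue one_half_ne_zero' one_half_ne_one' hDinv (Mk • I) I ht
  rw [mapGL_inv_inv] at t1
  have swap : greenPeriod (1 / 2) u (Mk • I) I = fun x => -(baseCorr hp σ (u := u) k x) := by
    funext x
    exact greenPeriod_swap hue one_half_ne_zero' one_half_ne_one' x I (Mk • I)
  rw [swap, lineSlash_neg_apply] at t1
  rw [← hD] at t1
  rw [← t1]
  -- second term: the cocycle at `δ⁻¹`
  have t2 : greenPeriod (1 / 2) u (D • I) I t =
      lewisZagierCocycle (1 / 2) I u (Matrix.SpecialLinearGroup.mapGL ℝ δ⁻¹) t := by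
    rw [lewisZagierCocycle, mapGL_inv_inv]
  rw [t2, ← add_assoc]
  rfl

/-- `slashHalf` by the `j`-th integer Hecke matrix is `lineSlash (1/2)` by `heckeGL j`. -/
theorem slashHalf_heckeMat (j : Fin (p + 1)) (φ : ℝ → ℂ) (t : ℝ) :
    Literature.NumberTheory.Automorphic.slashHalf (heckeMat p σ j) φ t = lineSlash (1 / 2) (heckeGL σ hp j) φ t :=
  slashHalf_eq_lineSlash _ _ _ _

include hu in
/-- Step 2 (per `j`, off finite sets): slash by `M_j` and substitute the rational-class
decomposition `r_{δ⁻¹} ≡ q_{δ⁻¹} + f|δ⁻¹ - f`. -/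
theorem step2 {γ δ : SL(2, ℤ)} (hδ : δ ∈ CongruenceSubgroup.Gamma1 N) {j k : Fin (p + 1)}
    (h : heckeMat p σ j * ((γ⁻¹ : SL(2, ℤ)) : Matrix (Fin 2) (Fin 2) ℤ) =
      (δ : Matrix (Fin 2) (Fin 2) ℤ) * heckeMat p σ k)
    {q : SL(2, ℤ) → ℝ → ℂ} {f : ℝ → ℂ}
    (hqf : ∀ᶠ t in cofinite, lewisZagierCocycle (1 / 2) UpperHalfPlane.I u (Matrix.SpecialLinearGroup.mapGL ℝ δ⁻¹) t =
      q δ⁻¹ t + lineSlash (1 / 2) (Matrix.SpecialLinearGroup.mapGL ℝ δ⁻¹) f t - f t) :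
    ∀ᶠ t in cofinite,
      lineSlash (1 / 2) (heckeGL σ hp j)
          (greenPeriod (1 / 2) u (heckeGL σ hp j • (γ⁻¹ • UpperHalfPlane.I)) (heckeGL σ hp j • UpperHalfPlane.I)) t =
        lineSlash (1 / 2) (heckeGL σ hp j) (q δ⁻¹) t +
          lineSlash (1 / 2) (Matrix.SpecialLinearGroup.mapGL ℝ γ) (lineSlash (1 / 2) (heckeGL σ hp k) f) t -
          lineSlash (1 / 2) (heckeGL σ hp j) f t +
          lineSlash (1 / 2) (heckeGL σ hp j) (baseCorr hp σ (u := u) j) t -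
          lineSlash (1 / 2) (Matrix.SpecialLinearGroup.mapGL ℝ γ)
            (lineSlash (1 / 2) (heckeGL σ hp k) (baseCorr hp σ (u := u) k)) t := by
  set I := UpperHalfPlane.I
  set Mj := heckeGL σ hp j with hMj
  set Mk := heckeGL σ hp k with hMk
  set D' := Matrix.SpecialLinearGroup.mapGL ℝ δ⁻¹ with hD'
  set G := Matrix.SpecialLinearGroup.mapGL ℝ γ with hG
  -- the matrix identity `δ⁻¹ M_j = M_k γ` in `GL₂(ℝ)`
  have hmat : D' * Mj = Mk * G := by
    have e := heckeGL_mul_eq σ hp h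
    rw [map_inv] at e
    rw [hD', map_inv, hMj, hMk, hG]
    calc (Matrix.SpecialLinearGroup.mapGL ℝ δ)⁻¹ * heckeGL σ hp j
        = (Matrix.SpecialLinearGroup.mapGL ℝ δ)⁻¹ * (heckeGL σ hp j * (Matrix.SpecialLinearGroup.mapGL ℝ γ)⁻¹) *
            Matrix.SpecialLinearGroup.mapGL ℝ γ := by group
      _ = heckeGL σ hp k * Matrix.SpecialLinearGroup.mapGL ℝ γ := by rw [e]; group
  -- Step 1 off the pole of `δ⁻¹`, combined with `hqf`
  have A : ∀ᶠ t in cofinite,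
      greenPeriod (1 / 2) u (Mj • (γ⁻¹ • I)) (Mj • I) t =
        -(lineSlash (1 / 2) D' (baseCorr hp σ (u := u) k) t) +
          (q δ⁻¹ t + lineSlash (1 / 2) D' f t - f t) + baseCorr hp σ (u := u) j t := by
    filter_upwards [eventually_cofinite_ne_linePole D', hqf] with t ht hq
    rw [step1 hp σ hu hδ h ht, hq]
  have B := lineSlash_congr_cofinite (1 / 2) Mj A
  filter_upwards [B, eventually_cofinite_ne_linePole Mj, eventually_cofinite_ne_linePole G] with t hB hpMj hpG
  rw [hB]
  -- linearity of the slash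
  have lin : lineSlash (1 / 2) Mj (fun t => -(lineSlash (1 / 2) D' (baseCorr hp σ (u := u) k) t) +
        (q δ⁻¹ t + lineSlash (1 / 2) D' f t - f t) + baseCorr hp σ (u := u) j t) t =
      -(lineSlash (1 / 2) Mj (lineSlash (1 / 2) D' (baseCorr hp σ (u := u) k)) t) +
        (lineSlash (1 / 2) Mj (q δ⁻¹) t + lineSlash (1 / 2) Mj (lineSlash (1 / 2) D' f) t -
          lineSlash (1 / 2) Mj f t) + lineSlash (1 / 2) Mj (baseCorr hp σ (u := u) j) t := by
    simp only [lineSlash_apply]; ring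
  rw [lin]
  -- `(φ | δ⁻¹) | M_j = φ | (δ⁻¹ M_j) = φ | (M_k γ) = (φ | M_k) | γ`
  have comp : ∀ φ : ℝ → ℂ, lineSlash (1 / 2) Mj (lineSlash (1 / 2) D' φ) t =
      lineSlash (1 / 2) G (lineSlash (1 / 2) Mk φ) t := fun φ => by
    rw [← lineSlash_mul (1 / 2) D' Mj φ hpMj, hmat, lineSlash_mul (1 / 2) Mk G φ hpG]
  rw [comp, comp]
  ring

include hu in
/-- Step 3 (summed over the `p + 1` matrices, off finite sets). -/
theorem step3 {γ : SL(2, ℤ)} (e : Equiv.Perm (Fin (p + 1))) (δ : Fin (p + 1) → SL(2, ℤ))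
    (hδ : ∀ j, δ j ∈ CongruenceSubgroup.Gamma1 N ∧
      heckeMat p σ j * ((γ⁻¹ : SL(2, ℤ)) : Matrix (Fin 2) (Fin 2) ℤ) =
        (δ j : Matrix (Fin 2) (Fin 2) ℤ) * heckeMat p σ (e j))
    {q : SL(2, ℤ) → ℝ → ℂ} {f : ℝ → ℂ}
    (hqf : ∀ j, ∀ᶠ t in cofinite,
      lewisZagierCocycle (1 / 2) UpperHalfPlane.I u (Matrix.SpecialLinearGroup.mapGL ℝ (δ j)⁻¹) t =
        q (δ j)⁻¹ t + lineSlash (1 / 2) (Matrix.SpecialLinearGroup.mapGL ℝ (δ j)⁻¹) f t - f t) :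
    ∀ᶠ t in cofinite,
      ∑ j : Fin (p + 1), lineSlash (1 / 2) (heckeGL σ hp j)
          (greenPeriod (1 / 2) u (heckeGL σ hp j • (γ⁻¹ • UpperHalfPlane.I)) (heckeGL σ hp j • UpperHalfPlane.I)) t =
        (∑ j : Fin (p + 1), lineSlash (1 / 2) (heckeGL σ hp j) (q (δ j)⁻¹) t) +
          (lineSlash (1 / 2) (Matrix.SpecialLinearGroup.mapGL ℝ γ)
              (fun x => ∑ j : Fin (p + 1), lineSlash (1 / 2) (heckeGL σ hp j) f x -
                ∑ j : Fin (p + 1), lineSlash (1 / 2) (heckeGL σ hp j) (baseCorr hp σ (u := u) j) x) t -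
            (∑ j : Fin (p + 1), lineSlash (1 / 2) (heckeGL σ hp j) f t -
              ∑ j : Fin (p + 1), lineSlash (1 / 2) (heckeGL σ hp j) (baseCorr hp σ (u := u) j) t)) := by
  have hall : ∀ᶠ t in cofinite, ∀ j : Fin (p + 1),
      lineSlash (1 / 2) (heckeGL σ hp j)
          (greenPeriod (1 / 2) u (heckeGL σ hp j • (γ⁻¹ • UpperHalfPlane.I)) (heckeGL σ hp j • UpperHalfPlane.I)) t =
        lineSlash (1 / 2) (heckeGL σ hp j) (q (δ j)⁻¹) t +
          lineSlash (1 / 2) (Matrix.SpecialLinearGroup.mapGL ℝ γ) (lineSlash (1 / 2) (heckeGL σ hp (e j)) f) t -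
          lineSlash (1 / 2) (heckeGL σ hp j) f t +
          lineSlash (1 / 2) (heckeGL σ hp j) (baseCorr hp σ (u := u) j) t -
          lineSlash (1 / 2) (Matrix.SpecialLinearGroup.mapGL ℝ γ)
            (lineSlash (1 / 2) (heckeGL σ hp (e j)) (baseCorr hp σ (u := u) (e j))) t :=
    Filter.eventually_all.mpr fun j => step2 hp σ hu (hδ j).1 (hδ j).2 (hqf j)
  filter_upwards [hall] with t ht
  rw [Finset.sum_congr rfl fun j _ => ht j]
  simp only [Finset.sum_add_distrib, Finset.sum_sub_distrib, lineSlash_sub_apply, lineSlash_finset_sum]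
  rw [Equiv.sum_comp e (fun i => lineSlash (1 / 2) (Matrix.SpecialLinearGroup.mapGL ℝ γ)
      (lineSlash (1 / 2) (heckeGL σ hp i) f) t),
    Equiv.sum_comp e (fun i => lineSlash (1 / 2) (Matrix.SpecialLinearGroup.mapGL ℝ γ)
      (lineSlash (1 / 2) (heckeGL σ hp i) (baseCorr hp σ (u := u) i)) t)]
  ring

end Main

/-! ## The assembly -/

section Assembly

/-- Finite sums of functions, applied. -/
theorem sum_fn_eq {ι : Type*} (S : Finset ι) (g : ι → ℝ → ℂ) :
    (fun x => ∑ i ∈ S, g i x) = ∑ i ∈ S, g i := by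
  funext x; simp [Finset.sum_apply]

/-- **Assembly**: `HeckeStableQuarterForms → HeckeCosetPermutation → HeckePeriodIntertwining →
HeckePreservesRationalPeriods`. Given the rational-class data `(q, f)` of `u` and, for each
`γ ∈ Γ₁(N)`, the permutation data `M_j γ⁻¹ = δ_j M_{e j}` (piece 2), the Hecke translate
`T'_p u` has the rational-class data `q'_γ = Σ_j q_{δ_j⁻¹} | M_j` (piecewise rational: `PR_ℚ` is
stable under the determinant-free slash of integer matrices and sums — tree facts) and
`f' = Σ_j f | M_j - Σ_j F_j | M_j` with the base-point corrections `F_j = ∫_I^{M_j I}` (semi-analytic: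
tree facts); the identity `r^{T'u}_γ ≡ q'_γ + f'|γ - f'` is piece 3 (intertwining) unfolded by
path additivity and `Γ`-equivariance of the period integral (tree) along piece 2, and the cocycle
law of `q'` follows from that of `r^{T'u}` (tree, using piece 1) by difference of cocycles. -/
theorem heckePreservesRationalPeriods_of_subs : HeckePreservesRationalPeriodsOfSubs := by
  classical
  intro hX1 hX2 hX3
  replace hX1 := heckeStableQuarterForms_iff.mp hX1
  replace hX2 := heckeCosetPermutation_iff.mp hX2
  replace hX3 := heckePeriodIntertwining_iff.mp hX3
  show HeckePreservesRationalPeriodsR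
  intro N hN p hp hpN σ hσ hσp u hu hr
  have huT : IsQuarterCuspFormR N (heckeT p σ u) := hX1 N hN p hp hpN σ hσ hσp u hu
  refine ⟨huT, ?_⟩
  obtain ⟨q, f, hqPR, hqcoc, hfsa, hqf⟩ := hr
  choose e δ hδ using hX2 N hN p hp hpN σ hσ hσp
  have hueT := isInvariantEigenfunction_of_isQuarterCuspFormR huT
  -- the new data
  set fT : ℝ → ℂ := fun x => ∑ j : Fin (p + 1), lineSlash (1 / 2) (heckeGL σ hp j) f x -
    ∑ j : Fin (p + 1), lineSlash (1 / 2) (heckeGL σ hp j) (baseCorr hp σ (u := u) j) x with hfT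
  set q' : SL(2, ℤ) → ℝ → ℂ := fun γ x => if hγ : γ ∈ CongruenceSubgroup.Gamma1 N then
    ∑ j : Fin (p + 1), lineSlash (1 / 2) (heckeGL σ hp j) (q (δ γ⁻¹ (inv_mem hγ) j)⁻¹) x else 0 with hq'
  -- the rational-class identity of `u`, in library form
  have hqf' : ∀ η ∈ CongruenceSubgroup.Gamma1 N, ∀ᶠ t in cofinite,
      lewisZagierCocycle (1 / 2) UpperHalfPlane.I u (Matrix.SpecialLinearGroup.mapGL ℝ η) t =
        q η t + lineSlash (1 / 2) (Matrix.SpecialLinearGroup.mapGL ℝ η) f t - f t := by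
    intro η hη
    have h := hqf η hη
    simp only [lzCocycleR_eq, slashHalfR_eq_lineSlash] at h
    exact h
  -- MAIN IDENTITY: `r^{T'u}_γ ≡ q'_γ + f'|γ - f'`
  have mainId : ∀ γ (hγ : γ ∈ CongruenceSubgroup.Gamma1 N), ∀ᶠ t in cofinite,
      lewisZagierCocycle (1 / 2) UpperHalfPlane.I (heckeT p σ u) (Matrix.SpecialLinearGroup.mapGL ℝ γ) t =
        q' γ t + lineSlash (1 / 2) (Matrix.SpecialLinearGroup.mapGL ℝ γ) fT t - fT t := by
    intro γ hγ
    have h3 := hX3 N hN p hp hpN σ hσ hσp u hu γ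
    have hS := step3 hp σ hu (γ := γ) (e γ⁻¹ (inv_mem hγ)) (δ γ⁻¹ (inv_mem hγ))
      (hδ γ⁻¹ (inv_mem hγ)) (q := q) (f := f)
      (fun j => hqf' _ (inv_mem ((hδ γ⁻¹ (inv_mem hγ) j).1)))
    filter_upwards [h3, hS] with t h3t hSt
    rw [h3t]
    simp only [slashHalf_heckeMat hp σ, heckeAct_eq_smul σ hp] 
    rw [hSt, hq']
    simp only [dif_pos hγ]
    rw [hfT]
    ring
  refine ⟨q', fT, ?_, ?_, ?_, ?_⟩
  · -- `q'_γ ∈ PR_ℚ`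
    intro γ hγ
    rw [isPRQR_iff, hq']
    simp only [dif_pos hγ]
    rw [sum_fn_eq]
    refine (piecewiseRational ℚ).sum_mem fun j _ => ?_
    rw [mem_piecewiseRational]
    have e1 : lineSlash (1 / 2) (heckeGL σ hp j) (q (δ γ⁻¹ (inv_mem hγ) j)⁻¹) =
        Literature.NumberTheory.Automorphic.slashHalf (heckeMat p σ j) (q (δ γ⁻¹ (inv_mem hγ) j)⁻¹) := by
      funext x; exact (slashHalf_heckeMat hp σ j _ x).symm
    rw [e1]
    exact ((isPRQR_iff _).mp (hqPR _ (inv_mem (hδ γ⁻¹ (inv_mem hγ) j).1))).slashHalf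
      (heckeMat_det_ne_zero σ hp j)
  · -- the cocycle law of `q'`, by difference of cocycles
    intro γ hγ γ' hγ'
    have hm := mainId γ hγ
    have hm' := mainId γ' hγ'
    have hmm := mainId (γ * γ') (mul_mem hγ hγ')
    have hcoc := lewisZagierCocycle_mul_cofinite hueT one_half_ne_zero' one_half_ne_one'
      (mapGL_mem_Gamma1GL hγ) (mapGL_mem_Gamma1GL hγ') UpperHalfPlane.I
    set G := Matrix.SpecialLinearGroup.mapGL ℝ γ with hG
    set D := Matrix.SpecialLinearGroup.mapGL ℝ γ' with hD
    have hq'γ : ∀ᶠ x in cofinite, q' γ x =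
        lewisZagierCocycle (1 / 2) UpperHalfPlane.I (heckeT p σ u) G x - lineSlash (1 / 2) G fT x + fT x :=
      hm.mono fun x hx => by rw [hx]; ring
    have hslash := lineSlash_congr_cofinite (1 / 2) D hq'γ
    rw [map_mul] at hmm
    filter_upwards [hm', hmm, hcoc, hslash, eventually_cofinite_ne_linePole D] with t h1 h2 h3 h4 h5
    rw [slashHalfR_eq_lineSlash, ← hD, h4]
    have lin : lineSlash (1 / 2) D (fun x =>
        lewisZagierCocycle (1 / 2) UpperHalfPlane.I (heckeT p σ u) G x - lineSlash (1 / 2) G fT x + fT x) t =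
        lineSlash (1 / 2) D (lewisZagierCocycle (1 / 2) UpperHalfPlane.I (heckeT p σ u) G) t -
          lineSlash (1 / 2) D (lineSlash (1 / 2) G fT) t + lineSlash (1 / 2) D fT t := by
      simp only [lineSlash_apply]; ring
    rw [lin, ← lineSlash_mul (1 / 2) G D fT h5]
    have e2 : q' (γ * γ') t = lewisZagierCocycle (1 / 2) UpperHalfPlane.I (heckeT p σ u) (G * D) t -
        lineSlash (1 / 2) (G * D) fT t + fT t := by rw [h2]; ring
    have e1 : q' γ' t = lewisZagierCocycle (1 / 2) UpperHalfPlane.I (heckeT p σ u) D t -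
        lineSlash (1 / 2) D fT t + fT t := by rw [h1]; ring
    rw [e2, e1, h3]
    ring
  · -- `f'` is semi-analytic
    rw [isSemiAnalyticR_iff, ← mem_semiAnalyticLineVectors, hfT]
    have e1 : (fun x => ∑ j : Fin (p + 1), lineSlash (1 / 2) (heckeGL σ hp j) f x -
        ∑ j : Fin (p + 1), lineSlash (1 / 2) (heckeGL σ hp j) (baseCorr hp σ (u := u) j) x) =
        (∑ j : Fin (p + 1), lineSlash (1 / 2) (heckeGL σ hp j) f) -
          ∑ j : Fin (p + 1), lineSlash (1 / 2) (heckeGL σ hp j) (baseCorr hp σ (u := u) j) := by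
      funext x; simp [Finset.sum_apply]
    rw [e1]
    refine Submodule.sub_mem _ (Submodule.sum_mem _ fun j _ => ?_) (Submodule.sum_mem _ fun j _ => ?_)
    · exact lineSlash_mem_semiAnalyticLineVectors _ _ ((mem_semiAnalyticLineVectors).mpr ((isSemiAnalyticR_iff f).mp hfsa))
    · exact lineSlash_mem_semiAnalyticLineVectors _ _ ((mem_semiAnalyticLineVectors).mpr (isSemiAnalyticVector_baseCorr hp σ hu j))
  · -- the identity itself, back in the route's notation
    intro γ hγ
    have hm := mainId γ hγ
    filter_upwards [hm] with t ht
    rw [lzCocycleR_eq, slashHalfR_eq_lineSlash]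
    exact ht

end Assembly


/-! ## Piece 2 PROVED: the coset permutation from the tree's coset representatives -/

section CosetPermutationProof

open CongruenceSubgroup Matrix.SpecialLinearGroup ModularGroup
open Literature.NumberTheory.EllipticCurves.ModularForms

/-- `Fin (p+1) ≃ Option (Fin p)`: `j < p ↦ some j`, `p ↦ none`. [folklore] -/
def idxEquiv (p : ℕ) : Fin (p + 1) ≃ Option (Fin p) where
  toFun k := if h : (k : ℕ) < p then some ⟨k, h⟩ else none
  invFun i := i.elim (Fin.last p) Fin.castSucc
  left_inv k := by
    by_cases h : (k : ℕ) < p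
    · simp only [h, dif_pos, Option.elim_some]
      ext; simp
    · simp only [h, dif_neg, not_false_eq_true, Option.elim_none]
      ext
      simp only [Fin.val_last]
      have := k.2
      omega
  right_inv i := by
    cases i with
    | none => simp
    | some j => simp [j.2]

/-- `idxEquiv` on indices `< p`. [folklore] -/
theorem idxEquiv_of_lt {p : ℕ} {k : Fin (p + 1)} (h : (k : ℕ) < p) : idxEquiv p k = some ⟨k, h⟩ := by
  simp [idxEquiv, h]

/-- `idxEquiv` on the last index. [folklore] -/
theorem idxEquiv_of_not_lt {p : ℕ} {k : Fin (p + 1)} (h : ¬ (k : ℕ) < p) : idxEquiv p k = none := by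
  simp [idxEquiv, h]

/-- The coset representatives `t_k ∈ Γ₁(N)`: `T^k` for `k < p`, the extra `X` for `k = p`.
[cite: DiamondShurman2005, §5.2 p. 170] -/
def rep (p : ℕ) (X : SL(2, ℤ)) (k : Fin (p + 1)) : SL(2, ℤ) :=
  (idxEquiv p k).elim X fun j => T ^ ((j : ℕ) : ℤ)

/-- `diag(1, p)` as an integer matrix. [folklore] -/
def Gz (p : ℕ) : Matrix (Fin 2) (Fin 2) ℤ := !![1, 0; 0, (p : ℤ)]



/-- `diag(1, p)` in `GL₂(ℝ)`. [folklore] -/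
theorem Gz_map (p : ℕ) : (Gz p).map (Int.cast : ℤ → ℝ) = !![(1 : ℝ), 0; 0, (p : ℝ)] := by
  ext i j
  fin_cases i <;> fin_cases j <;> simp [Gz]

/-- `diag(1, p)` in `GL₂(ℝ)`. [folklore] -/
def Ggl (p : ℕ) (hp : p.Prime) : GL (Fin 2) ℝ :=
  Matrix.GeneralLinearGroup.mkOfDetNeZero ((Gz p).map (Int.cast : ℤ → ℝ)) (by
    rw [Gz_map, Matrix.det_fin_two_of]; simp; exact_mod_cast hp.ne_zero)

/-- Underlying real matrix of `Ggl`. [folklore] -/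
theorem Ggl_coe (p : ℕ) (hp : p.Prime) :
    ((Ggl p hp : GL (Fin 2) ℝ) : Matrix (Fin 2) (Fin 2) ℝ) = (Gz p).map (Int.cast : ℤ → ℝ) := rfl

/-- Underlying real matrix of `Ggl`, explicitly. [folklore] -/
theorem Ggl_coe' (p : ℕ) (hp : p.Prime) :
    ((Ggl p hp : GL (Fin 2) ℝ) : Matrix (Fin 2) (Fin 2) ℝ) = !![1, 0; 0, (p : ℝ)] := by
  rw [Ggl_coe, Gz_map]

/-- From `diag(1,p) γ' t⁻¹ diag(1,p)⁻¹ ∈ Γ₁(N)` (in `GL₂(ℝ)`) to the integer identity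
`diag(1,p) γ' = δ t diag… `: precisely, `∃ δ ∈ Γ₁(N)`, `Gz γ' = δ Gz t`. [folklore] -/
theorem exists_delta_of_mem {N p : ℕ} (hp : p.Prime) {γ' t : SL(2, ℤ)}
    (h : Ggl p hp * mapGL ℝ γ' * (mapGL ℝ t)⁻¹ * (Ggl p hp)⁻¹ ∈ (Gamma1 N : Subgroup (GL (Fin 2) ℝ))) :
    ∃ δ : SL(2, ℤ), δ ∈ Gamma1 N ∧
      Gz p * (γ' : Matrix (Fin 2) (Fin 2) ℤ) = (δ : Matrix (Fin 2) (Fin 2) ℤ) * (Gz p * (t : Matrix (Fin 2) (Fin 2) ℤ)) := by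
  obtain ⟨δ, hδ, hδeq⟩ := h
  refine ⟨δ, hδ, ?_⟩
  have e : (mapGL ℝ δ : GL (Fin 2) ℝ) * Ggl p hp * mapGL ℝ t = Ggl p hp * mapGL ℝ γ' := by
    rw [hδeq]; group
  have e' := congrArg (fun g : GL (Fin 2) ℝ => (g : Matrix (Fin 2) (Fin 2) ℝ)) e
  simp only [Units.val_mul, mapGL_coe_eq_map, Ggl_coe, ← map_intCast_mul] at e'
  have hinj := Matrix.map_injective (m := Fin 2) (n := Fin 2) (Int.cast_injective (α := ℝ))
  have := hinj e'
  rw [← this, Matrix.mul_assoc]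

/-- **stub_heckeCosetPermutation** (registered stub of `Lines/decomposition.lean` on
stmt-Langlands-2807; child `HeckeCosetPermutation`), PROVED from the tree's coset representatives.
[cite: DiamondShurman2005, §5.2 and Prop. 5.2.1] -/
theorem stub_heckeCosetPermutation : ∀ N : ℕ, 0 < N → ∀ p : ℕ, p.Prime → ¬ p ∣ N → ∀ σ ∈ CongruenceSubgroup.Gamma0 N, (((σ : Matrix (Fin 2) (Fin 2) ℤ) 1 1 : ℤ) : ZMod N) = (p : ZMod N) → let M : Fin (p + 1) → Matrix (Fin 2) (Fin 2) ℤ := (fun j : Fin (p + 1) => if (j : ℕ) < p then !![(1 : ℤ), ((j : ℕ) : ℤ); 0, (p : ℤ)] else (σ : Matrix (Fin 2) (Fin 2) ℤ) * !![(p : ℤ), 0; 0, 1]); ∀ γ ∈ CongruenceSubgroup.Gamma1 N, ∃ (e : Equiv.Perm (Fin (p + 1))) (δ : Fin (p + 1) → Matrix.SpecialLinearGroup (Fin 2) ℤ), ∀ j : Fin (p + 1), δ j ∈ CongruenceSubgroup.Gamma1 N ∧ M j * (γ : Matrix (Fin 2) (Fin 2) ℤ) = (δ j : Matrix (Fin 2)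 (Fin 2) ℤ) * M (e j) := by
  intro N hN p hp hpN σ hσ hσp
  show ∀ γ ∈ Gamma1 N, ∃ (e : Equiv.Perm (Fin (p + 1))) (δ : Fin (p + 1) → SL(2, ℤ)),
    ∀ j : Fin (p + 1), δ j ∈ Gamma1 N ∧
      heckeMat p σ j * (γ : Matrix (Fin 2) (Fin 2) ℤ) = (δ j : Matrix (Fin 2) (Fin 2) ℤ) * heckeMat p σ (e j)
  haveI : NeZero N := ⟨hN.ne'⟩
  -- the extra representative and the matrix `M = (m n; N p)`
  obtain ⟨X, hX10, hX11, hX00⟩ := HeckeTGamma1.exists_X N hp hpN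
  obtain ⟨m, hm⟩ := hX00
  have hXdet : X 0 0 * X 1 1 - X 0 1 * X 1 0 = 1 := by
    have := X.2; rwa [Matrix.det_fin_two] at this
  rw [hX10, hX11, hm] at hXdet
  have hMdet : !![m, X 0 1; (N : ℤ), (p : ℤ)].det = 1 := by
    rw [Matrix.det_fin_two_of]; linarith
  set M : SL(2, ℤ) := ⟨_, hMdet⟩ with hM
  have hM0 : M ∈ Gamma0 N := by simp [Gamma0_mem, hM]
  have hMp : Gamma0Map N ⟨M, hM0⟩ = (p : ZMod N) := by simp [Gamma0Map, hM]
  have hσp' : Gamma0Map N ⟨σ, hσ⟩ = (p : ZMod N) := hσp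
  -- `ε_p = σ M⁻¹ ∈ Γ₁(N)`
  have hεmem : σ * M⁻¹ ∈ Gamma1 N := by
    have : Gamma0Map N (⟨σ, hσ⟩ * (⟨M, hM0⟩ : Gamma0 N)⁻¹) = 1 := by
      rw [map_mul, hσp', ← hMp, ← map_mul, mul_inv_cancel, map_one]
    exact mem_gamma1_of_gamma0Map_eq_one N this
  -- the representatives lie in `Γ₁(N)`
  have hX1 : X ∈ Gamma1 N := HeckeTGamma1.mem_Gamma1_of_entries N hX10 hX11
  have hrep : ∀ k : Fin (p + 1), rep p X k ∈ Gamma1 N := by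
    intro k
    unfold rep
    by_cases hk : (k : ℕ) < p
    · rw [idxEquiv_of_lt hk]; exact HeckeTGamma1.T_zpow_mem_Gamma1 N _
    · rw [idxEquiv_of_not_lt hk]; exact hX1
  -- `ε_k` and the factorisation `M_k = ε_k · Gz · t_k`
  let ε : Fin (p + 1) → SL(2, ℤ) := fun k => if (k : ℕ) < p then 1 else σ * M⁻¹
  have hεΓ : ∀ k, ε k ∈ Gamma1 N := by
    intro k; by_cases hk : (k : ℕ) < p
    · simp only [ε, hk, if_true]; exact one_mem _
    · simp only [ε, hk, if_false]; exact hεmem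
  have hGX : Gz p * (X : Matrix (Fin 2) (Fin 2) ℤ) = (M : Matrix (Fin 2) (Fin 2) ℤ) * !![(p : ℤ), 0; 0, 1] := by
    ext i j
    fin_cases i <;> fin_cases j <;>
      simp [Gz, hM, Matrix.mul_apply, Fin.sum_univ_two, hm, hX10, hX11, mul_comm]
  have hfac : ∀ k : Fin (p + 1),
      heckeMat p σ k = (ε k : Matrix (Fin 2) (Fin 2) ℤ) * (Gz p * (rep p X k : Matrix (Fin 2) (Fin 2) ℤ)) := by
    intro k
    unfold heckeMat rep
    by_cases hk : (k : ℕ) < p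
    · simp only [hk, if_true, idxEquiv_of_lt hk, Option.elim_some, ε, Matrix.SpecialLinearGroup.coe_one, Matrix.one_mul, ModularGroup.coe_T_zpow, Gz]
      ext i j
      fin_cases i <;> fin_cases j <;> simp [Matrix.mul_apply, Fin.sum_univ_two]
    · simp only [hk, if_false, idxEquiv_of_not_lt hk, Option.elim_none, ε]
      rw [hGX, ← Matrix.mul_assoc, Matrix.SpecialLinearGroup.coe_mul]
      congr 1
      have hMM : ((M⁻¹ : SL(2, ℤ)) : Matrix (Fin 2) (Fin 2) ℤ) * (M : Matrix (Fin 2) (Fin 2) ℤ) = 1 := by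
        rw [← Matrix.SpecialLinearGroup.coe_mul, inv_mul_cancel, Matrix.SpecialLinearGroup.coe_one]
      rw [Matrix.mul_assoc, hMM, Matrix.mul_one]
  -- the tree's unique-coset statement, transported to the index type `Fin (p+1)`
  have hG : ((Ggl p hp : GL (Fin 2) ℝ) : Matrix (Fin 2) (Fin 2) ℝ) = !![1, 0; 0, (p : ℝ)] := Ggl_coe' p hp
  have hX00' : (p : ℤ) ∣ X 0 0 := ⟨m, hm⟩
  have hEU : ∀ γ' : SL(2, ℤ), γ' ∈ Gamma1 N → ∃! k : Fin (p + 1),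
      Ggl p hp * mapGL ℝ γ' * (mapGL ℝ (rep p X k))⁻¹ * (Ggl p hp)⁻¹ ∈ (Gamma1 N : Subgroup (GL (Fin 2) ℝ)) := by
    intro γ' hγ'
    have h := HeckeTGamma1.existsUnique_option N hp hG hX10 hX11 hX00' (mapGL ℝ γ')
      (Subgroup.mem_map_of_mem _ hγ')
    refine ((idxEquiv p).existsUnique_congr fun k => ?_).mpr h
    rfl
  intro γ hγ
  -- cover: index and `δ` for each `j`
  have hcov : ∀ j : Fin (p + 1), ∃ (k : Fin (p + 1)) (δ : SL(2, ℤ)), δ ∈ Gamma1 N ∧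
      Ggl p hp * mapGL ℝ (rep p X j * γ) * (mapGL ℝ (rep p X k))⁻¹ * (Ggl p hp)⁻¹ ∈ (Gamma1 N : Subgroup (GL (Fin 2) ℝ)) ∧
      heckeMat p σ j * (γ : Matrix (Fin 2) (Fin 2) ℤ) = (δ : Matrix (Fin 2) (Fin 2) ℤ) * heckeMat p σ k := by
    intro j
    obtain ⟨k, hk, -⟩ := hEU (rep p X j * γ) (mul_mem (hrep j) hγ)
    obtain ⟨δ₀, hδ₀, hδ₀eq⟩ := exists_delta_of_mem hp hk
    refine ⟨k, ε j * δ₀ * (ε k)⁻¹, mul_mem (mul_mem (hεΓ j) hδ₀) (inv_mem (hεΓ k)), hk, ?_⟩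
    rw [hfac j, hfac k, Matrix.SpecialLinearGroup.coe_mul, Matrix.SpecialLinearGroup.coe_mul]
    have hEE : (((ε k)⁻¹ : SL(2, ℤ)) : Matrix (Fin 2) (Fin 2) ℤ) * (ε k : Matrix (Fin 2) (Fin 2) ℤ) = 1 := by
      rw [← Matrix.SpecialLinearGroup.coe_mul, inv_mul_cancel, Matrix.SpecialLinearGroup.coe_one]
    calc (ε j : Matrix (Fin 2) (Fin 2) ℤ) * (Gz p * (rep p X j : Matrix (Fin 2) (Fin 2) ℤ)) * (γ : Matrix (Fin 2) (Fin 2) ℤ)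
        = (ε j : Matrix (Fin 2) (Fin 2) ℤ) * (Gz p * ((rep p X j * γ : SL(2, ℤ)) : Matrix (Fin 2) (Fin 2) ℤ)) := by
          rw [Matrix.SpecialLinearGroup.coe_mul]; simp only [Matrix.mul_assoc]
      _ = (ε j : Matrix (Fin 2) (Fin 2) ℤ) * ((δ₀ : Matrix (Fin 2) (Fin 2) ℤ) * (Gz p * (rep p X k : Matrix (Fin 2) (Fin 2) ℤ))) := by
          rw [hδ₀eq]
      _ = (ε j : Matrix (Fin 2) (Fin 2) ℤ) * (δ₀ : Matrix (Fin 2) (Fin 2) ℤ) * (((ε k)⁻¹ : SL(2, ℤ)) : Matrix (Fin 2) (Fin 2) ℤ) *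
            ((ε k : Matrix (Fin 2) (Fin 2) ℤ) * (Gz p * (rep p X k : Matrix (Fin 2) (Fin 2) ℤ))) := by
          simp only [Matrix.mul_assoc]
          rw [← Matrix.mul_assoc (((ε k)⁻¹ : SL(2, ℤ)) : Matrix (Fin 2) (Fin 2) ℤ), hEE, Matrix.one_mul]
  choose kk δ hδΓ hkk hδeq using hcov
  -- injectivity of `j ↦ kk j` by uniqueness
  have hinj : Function.Injective kk := by
    intro j₁ j₂ hj
    have h1 := hkk j₁
    have h2 := hkk j₂
    rw [← hj] at h2
    -- both `idx j₁` and `idx j₂` witness the unique coset of `rep j₁`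
    have hu := hEU (rep p X j₁) (hrep j₁)
    apply hu.unique
    · -- trivially in Γ₁: the element is 1
      have : Ggl p hp * mapGL ℝ (rep p X j₁) * (mapGL ℝ (rep p X j₁))⁻¹ * (Ggl p hp)⁻¹ = 1 := by group
      rw [this]; exact one_mem _
    · -- from h1, h2: `G t₁ γ k⁻¹ G⁻¹`, `G t₂ γ k⁻¹ G⁻¹ ∈ Γ₁` ⟹ `G t₁ t₂⁻¹ G⁻¹ ∈ Γ₁`
      have h12 := mul_mem h1 (inv_mem h2)
      have e : Ggl p hp * mapGL ℝ (rep p X j₁ * γ) * (mapGL ℝ (rep p X (kk j₁)))⁻¹ * (Ggl p hp)⁻¹ *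
          (Ggl p hp * mapGL ℝ (rep p X j₂ * γ) * (mapGL ℝ (rep p X (kk j₁)))⁻¹ * (Ggl p hp)⁻¹)⁻¹ =
          Ggl p hp * mapGL ℝ (rep p X j₁) * (mapGL ℝ (rep p X j₂))⁻¹ * (Ggl p hp)⁻¹ := by
        simp only [map_mul]; group
      rw [e] at h12
      exact h12
  refine ⟨Equiv.ofBijective kk hinj.bijective_of_finite, δ, fun j => ⟨hδΓ j, ?_⟩⟩
  exact hδeq j


end CosetPermutationProof


/-! ## Piece 1 PROVED: `T'_p` preserves the quarter cusp forms -/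

section StableFormsProof

variable {p : ℕ}

/-- `C²` is preserved by composition with the action of `g ∈ GL₂⁺(ℝ)`. [folklore] -/
theorem isC2_comp_smul {f : ℍ → ℂ} (hf : IsC2 f) {g : GL (Fin 2) ℝ} (hg : 0 < g.det.val) :
    IsC2 (fun w => f (g • w)) := by
  unfold IsC2
  rw [comp_smul_extend_eq]
  refine hf.comp (contDiffOn_smulExtend hg 2) fun z _ => ?_
  exact (g • ofComplex z).im_pos

/-- `T'_p u = Σ_j p^{-1/2} · (u ∘ M_j)` as functions on `ℍ`. [cite: DiamondShurman2005, Prop. 5.2.1] -/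
theorem heckeT_eq_sum (hp : p.Prime) (σ : SL(2, ℤ)) (u : ℍ → ℂ) :
    heckeT p σ u = fun z => ∑ j : Fin (p + 1), ((Real.sqrt p : ℝ) : ℂ)⁻¹ * u (heckeGL σ hp j • z) := by
  funext z
  simp only [← heckeAct_eq_smul σ hp]
  unfold heckeT heckeAct
  rw [← Finset.mul_sum, Fin.sum_univ_castSucc]
  congr 2
  · rw [Finset.sum_range]
    refine Finset.sum_congr rfl fun i _ => ?_
    simp only [Fin.val_castSucc, Fin.is_lt, if_true]
  · simp only [Fin.val_last, lt_self_iff_false, if_false]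

/-- **stub_heckeStableQuarterForms** (registered stub; child `HeckeStableQuarterForms`, crux), PROVED:
`T'_p` maps quarter cusp forms on `Γ₁(N)` to quarter cusp forms — `C²` by composition and sums,
`Γ₁(N)`-invariance by the coset permutation (piece 2), eigenvalue `1/4` by the `GL₂⁺(ℝ)`-invariance
of `Δ`, boundedness directly. [cite: DiamondShurman2005, Prop. 5.2.1] -/
theorem stub_heckeStableQuarterForms : let IsQuarterCuspForm : ℕ → (UpperHalfPlane → ℂ) → Prop := fun N u => Literature.NumberTheory.Automorphic.IsC2 u ∧ (∀ γ ∈ CongruenceSubgroup.Gamma1 N, ∀ z : UpperHalfPlane, u (γ • z) = u z) ∧ (∀ z : UpperHalfPlane, Literature.NumberTheory.Automorphic.hypLaplacian u z + (1 / 4 : ℂ) * u z = 0) ∧ ∃ C : ℝ, ∀ z : UpperHalfPlane, ‖u z‖ ≤ C; ∀ N : ℕ, 0 < N → ∀ p : ℕ, p.Prime → ¬ p ∣ N → ∀ σ ∈ CongruenceSubgroup.Gamma0 N, (((σ : Matrix (Fin 2) (Fin 2) ℤ) 1 1 : ℤ) : ZMod N) = (p : ZMod N) → ∀ u : UpperHalfPlane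 → ℂ, IsQuarterCuspForm N u → IsQuarterCuspForm N (fun z : UpperHalfPlane => ((Real.sqrt p : ℝ) : ℂ)⁻¹ * (∑ b ∈ Finset.range p, u (UpperHalfPlane.ofComplex (((z : ℂ) + b) / p)) + u (σ • UpperHalfPlane.ofComplex ((p : ℂ) * (z : ℂ))))) := by
  intro IsQCF N hN p hp hpN σ hσ hσp u hu
  show IsQuarterCuspFormR N (heckeT p σ u)
  obtain ⟨hC2, hinv, heig, C, hC⟩ := (hu : IsQuarterCuspFormR N u)
  have hX2 : ∀ γ ∈ CongruenceSubgroup.Gamma1 N, ∃ (e : Equiv.Perm (Fin (p + 1)))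
      (δ : Fin (p + 1) → SL(2, ℤ)), ∀ j : Fin (p + 1), δ j ∈ CongruenceSubgroup.Gamma1 N ∧
        heckeMat p σ j * (γ : Matrix (Fin 2) (Fin 2) ℤ) = (δ j : Matrix (Fin 2) (Fin 2) ℤ) * heckeMat p σ (e j) :=
    stub_heckeCosetPermutation N hN p hp hpN σ hσ hσp
  have hsum := heckeT_eq_sum hp σ u
  set c : ℂ := ((Real.sqrt p : ℝ) : ℂ)⁻¹ with hc
  have hC2j : ∀ j : Fin (p + 1), IsC2 (fun w => u (heckeGL σ hp j • w)) := fun j =>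
    isC2_comp_smul hC2 (heckeGL_det_pos σ hp j)
  refine ⟨?_, ?_, ?_, ?_⟩
  · -- `C²`
    rw [hsum]
    exact isC2_finset_sum Finset.univ (fun _ => c) (fun j w => u (heckeGL σ hp j • w)) fun j _ => hC2j j
  · -- `Γ₁(N)`-invariance
    intro γ hγ z
    rw [hsum]
    obtain ⟨e, δ, hδ⟩ := hX2 γ hγ
    have key : ∀ j : Fin (p + 1), u (heckeGL σ hp j • γ • z) = u (heckeGL σ hp (e j) • z) := fun j => by
      rw [sl_smul_eq_mapGL_smul, ← mul_smul, heckeGL_mul_eq σ hp (hδ j).2, mul_smul,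
        ← sl_smul_eq_mapGL_smul, hinv _ (hδ j).1]
    simp only [key]
    exact Fintype.sum_equiv e _ _ fun j => rfl
  · -- eigenvalue `1/4`
    intro z
    rw [hsum, hypLaplacian_finset_sum Finset.univ (fun _ => c) (fun j w => u (heckeGL σ hp j • w))
      (fun j _ => hC2j j) z]
    rw [Finset.mul_sum, ← Finset.sum_add_distrib]
    refine Finset.sum_eq_zero fun j _ => ?_
    have hcd : ContDiffAt ℝ 2 (u ∘ ofComplex) ((heckeGL σ hp j • z : ℍ) : ℂ) :=
      hC2.contDiffAt (isOpen_upperHalfPlaneSet.mem_nhds (heckeGL σ hp j • z).im_pos)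
    rw [hypLaplacian_comp_smul (heckeGL_det_pos σ hp j) u z hcd]
    have h := heig (heckeGL σ hp j • z)
    linear_combination c * h
  · -- boundedness
    refine ⟨‖c‖ * (∑ b ∈ Finset.range p, C + C), fun z => ?_⟩
    show ‖((Real.sqrt p : ℝ) : ℂ)⁻¹ * (∑ b ∈ Finset.range p,
        u (UpperHalfPlane.ofComplex (((z : ℂ) + b) / p)) + u (σ • UpperHalfPlane.ofComplex ((p : ℂ) * (z : ℂ))))‖ ≤ _
    rw [norm_mul]
    refine mul_le_mul_of_nonneg_left ?_ (norm_nonneg _)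
    exact (norm_add_le _ _).trans
      (add_le_add ((norm_sum_le _ _).trans (Finset.sum_le_sum fun b _ => hC _)) (hC _))

end StableFormsProof


/-! ## Piece 3 PROVED: linearity and the pull-back law of the period integral, and the intertwining -/

section PeriodLaws

/-- A `C²` `λ_s`-eigenfunction on `ℍ` is an invariant eigenfunction for the trivial group. [folklore] -/
theorem isInvariantEigenfunction_bot {s : ℂ} {u : ℍ → ℂ} (hC2 : IsC2 u)
    (heig : ∀ z : ℍ, hypLaplacian u z + s * (1 - s) * u z = 0) :
    IsInvariantEigenfunction (⊥ : Subgroup (GL (Fin 2) ℝ)) s u :=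
  ⟨hC2, heig, fun γ hγ z => by rw [Subgroup.mem_bot.mp hγ, one_smul]⟩

/-- **Pull-back law** (BLZ (2.25) + (1.10a) + (1.10c)): for `g ∈ GL₂⁺(ℝ)`, a `C²` `λ_s`-eigenfunction
`u` (`s ≠ 0, 1`) and `t` off the pole of `g`,
`∫_a^b [u∘g, R(t;·)^s] = (det g)^s · |ct+d|^{-2s} · ∫_{ga}^{gb} [u, R(gt;·)^s]`.
[cite: BruggemanLewisZagier2015, (2.25) p. 16 and (1.10a) p. 11] -/
theorem greenPeriod_comp_smul {s : ℂ} (hs0 : s ≠ 0) (hs1 : s ≠ 1) {u : ℍ → ℂ} {g : GL (Fin 2) ℝ}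
    (hg : 0 < g.det.val) (hC2 : IsC2 u) (heig : ∀ z : ℍ, hypLaplacian u z + s * (1 - s) * u z = 0)
    (a b : ℍ) {t : ℝ} (ht : (g 1 0 : ℝ) * t + g 1 1 ≠ 0) :
    greenPeriod s (fun z => u (g • z)) a b t =
      ((g.det.val : ℝ) : ℂ) ^ s * lineSlash s g (greenPeriod s u (g • a) (g • b)) t := by
  have hue := isInvariantEigenfunction_bot hC2 heig
  set M : ℂ → ℂ := fun w : ℂ => ((g • ofComplex w : ℍ) : ℂ) with hM
  set t' : ℝ := (g 0 0 * t + g 0 1) / (g 1 0 * t + g 1 1) with ht'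
  set J : ℂ := ((|g 1 0 * t + g 1 1| : ℝ) : ℂ) ^ (-(2 * s)) with hJ
  set D : ℂ := ((g.det.val : ℝ) : ℂ) ^ s with hD
  -- `u ∘ g` on `ℂ`
  have hU : ((fun z => u (g • z)) ∘ ofComplex : ℂ → ℂ) = (u ∘ ofComplex) ∘ M := comp_smul_extend_eq g u
  -- `R(t; z)^s = (det g)^s |ct+d|^{-2s} R(gt; g z)^s` on `ℍ`
  have hdet0 : ((g.det.val : ℝ) : ℂ) ≠ 0 := by exact_mod_cast hg.ne'
  have hV : EqOn (hypPoissonKernelCpow s t) (fun z => (D * J) * (hypPoissonKernelCpow s t' ∘ M) z)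
      {z : ℂ | 0 < z.im} := by
    intro z hz
    have key := hypPoissonKernelCpow_glSmul s hg ⟨z, hz⟩ ht
    simp only [Function.comp_apply, hM, UpperHalfPlane.ofComplex_apply_of_im_pos hz]
    rw [← ht', ← hJ] at key
    -- key : J * R(t'; g z)^s = det^{-s} * R(t; z)^s
    have hDinv : D * ((g.det.val : ℝ) : ℂ) ^ (-s) = 1 := by
      have hne : ((g.det.val : ℝ) : ℂ) ^ s ≠ 0 := Complex.cpow_ne_zero_iff.mpr (Or.inl hdet0)
      rw [hD, Complex.cpow_neg, mul_inv_cancel₀ hne]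
    calc hypPoissonKernelCpow s t z
        = (D * ((g.det.val : ℝ) : ℂ) ^ (-s)) * hypPoissonKernelCpow s t z := by rw [hDinv, one_mul]
      _ = D * (((g.det.val : ℝ) : ℂ) ^ (-s) * hypPoissonKernelCpow s t (⟨z, hz⟩ : ℍ)) := by ring
      _ = D * (J * hypPoissonKernelCpow s t' ((g • (⟨z, hz⟩ : ℍ) : ℍ) : ℂ)) := by rw [← key]
      _ = D * J * hypPoissonKernelCpow s t' ((g • (⟨z, hz⟩ : ℍ) : ℍ) : ℂ) := by ring
  -- change of variables along `g`
  have hchg := greenSegmentIntegral_comp_smul (g := g) hg hue.isC2 (contDiffOn_hypPoissonKernelCpow s t')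
    (mul_laplacian_comm_of_eigen hue hs0 hs1 t') a b
  unfold greenPeriod
  rw [hU, greenSegmentIntegral_congr_upperHalfPlane (fun _ _ => rfl) hV a b,
    greenSegmentIntegral_const_mul, hchg, lineSlash_apply, ← hJ, ← ht']
  ring

/-- Pointwise linearity of the Green's form in the first function, given differentiability. [folklore] -/
theorem greenForm_finset_sum {ι : Type*} (S : Finset ι) (c : ι → ℂ) (U : ι → ℂ → ℂ) (V : ℂ → ℂ)
    {w : ℂ} (hU : ∀ i ∈ S, DifferentiableAt ℝ (U i) w) (h : ℂ) :
    greenForm (fun x => ∑ i ∈ S, c i * U i x) V w h = ∑ i ∈ S, c i * greenForm (U i) V w h := by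
  unfold greenForm wirtingerDz
  have hd : fderiv ℝ (fun x => ∑ i ∈ S, c i * U i x) w = ∑ i ∈ S, c i • fderiv ℝ (U i) w := by
    rw [fderiv_fun_sum fun i hi => (hU i hi).const_mul (c i)]
    exact Finset.sum_congr rfl fun i hi => fderiv_const_mul (hU i hi) (c i)
  rw [hd]
  simp only [FunLike.coe_sum, Finset.sum_apply, FunLike.coe_smul, Pi.smul_apply,
    smul_eq_mul, Finset.sum_mul, Finset.mul_sum, ← Finset.sum_sub_distrib, ← Finset.sum_add_distrib,
    Finset.sum_div]
  refine Finset.sum_congr rfl fun i _ => ?_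
  ring

/-- Continuity of `τ ↦ [U, V]((1-τ)a + τb)(h)` on `[0,1]` for `C²` data on `ℍ` and `a, b ∈ ℍ`. [folklore] -/
theorem continuousOn_greenForm_segment {U V : ℂ → ℂ} (hU : ContDiffOn ℝ 2 U {z : ℂ | 0 < z.im})
    (hV : ContDiffOn ℝ 2 V {z : ℂ | 0 < z.im}) (a b : ℍ) (h : ℂ) :
    ContinuousOn (fun τ : ℝ => greenForm U V ((1 - (τ : ℂ)) * (a : ℂ) + (τ : ℂ) * (b : ℂ)) h) (uIcc 0 1) := by
  have hO : IsOpen {z : ℂ | 0 < z.im} := isOpen_upperHalfPlaneSet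
  have hΩ := continuousOn_greenOneForm hO hU hV
  have hpath : Continuous fun τ : ℝ => (1 - (τ : ℂ)) * (a : ℂ) + (τ : ℂ) * (b : ℂ) := by fun_prop
  have hmaps : MapsTo (fun τ : ℝ => (1 - (τ : ℂ)) * (a : ℂ) + (τ : ℂ) * (b : ℂ)) (uIcc 0 1) {z : ℂ | 0 < z.im} := by
    intro τ hτ
    rw [uIcc_of_le zero_le_one] at hτ
    show 0 < ((1 - (τ : ℂ)) * (a : ℂ) + (τ : ℂ) * (b : ℂ)).im
    have ha : 0 < (a : ℂ).im := a.coe_im_pos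
    have hb : 0 < (b : ℂ).im := b.coe_im_pos
    simp only [Complex.add_im, Complex.mul_im, Complex.sub_re, Complex.one_re, Complex.ofReal_re,
      Complex.sub_im, Complex.one_im, Complex.ofReal_im, sub_zero, zero_mul, add_zero]
    rcases eq_or_lt_of_le hτ.1 with h0 | h0
    · rw [← h0]; simpa using ha
    · have : 0 ≤ 1 - τ := by linarith [hτ.2]
      nlinarith [mul_nonneg this ha.le, mul_pos h0 hb]
  have hcomp := (hΩ.comp hpath.continuousOn hmaps).clm_apply continuousOn_const (g := fun _ => h)
  refine hcomp.congr fun τ _ => ?_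
  simp only [Function.comp_apply, greenForm, add_apply, smul_apply,
    ContinuousLinearMap.id_apply, ContinuousLinearEquiv.coe_coe, Complex.conjCLE_apply, smul_eq_mul]

/-- **Linearity of the period integral** in `u` over `C²` functions on `ℍ` (the Green's form is
linear and each summand is integrable along the compact segment). [cite: BruggemanLewisZagier2015, (1.9) p. 11] -/
theorem greenPeriod_finset_sum (s : ℂ) {n : ℕ} (c : Fin n → ℂ) (v : Fin n → ℍ → ℂ)
    (hv : ∀ i, IsC2 (v i)) (a b : ℍ) (t : ℝ) :
    greenPeriod s (fun z => ∑ i, c i * v i z) a b t = ∑ i, c i * greenPeriod s (v i) a b t := by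
  unfold greenPeriod greenSegmentIntegral
  have hO : IsOpen {z : ℂ | 0 < z.im} := isOpen_upperHalfPlaneSet
  set dw : ℂ := (b : ℂ) - (a : ℂ)
  -- pointwise linearity along the segment
  have hpt : ∀ τ ∈ uIcc (0 : ℝ) 1,
      greenForm ((fun z => ∑ i, c i * v i z) ∘ ofComplex) (hypPoissonKernelCpow s t)
          ((1 - (τ : ℂ)) * (a : ℂ) + (τ : ℂ) * (b : ℂ)) dw =
        ∑ i, c i * greenForm (v i ∘ ofComplex) (hypPoissonKernelCpow s t)
          ((1 - (τ : ℂ)) * (a : ℂ) + (τ : ℂ) * (b : ℂ)) dw := by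
    intro τ hτ
    rw [uIcc_of_le zero_le_one] at hτ
    have hz : 0 < ((1 - (τ : ℂ)) * (a : ℂ) + (τ : ℂ) * (b : ℂ)).im := by
      have ha : 0 < (a : ℂ).im := a.coe_im_pos
      have hb : 0 < (b : ℂ).im := b.coe_im_pos
      simp only [Complex.add_im, Complex.mul_im, Complex.sub_re, Complex.one_re, Complex.ofReal_re,
        Complex.sub_im, Complex.one_im, Complex.ofReal_im, sub_zero, zero_mul, add_zero]
      rcases eq_or_lt_of_le hτ.1 with h0 | h0
      · rw [← h0]; simpa using ha
      · have : 0 ≤ 1 - τ := by linarith [hτ.2]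
        nlinarith [mul_nonneg this ha.le, mul_pos h0 hb]
    have e : ((fun z => ∑ i, c i * v i z) ∘ ofComplex : ℂ → ℂ) = fun x => ∑ i ∈ Finset.univ, c i * (v i ∘ ofComplex) x := by
      funext x; simp
    rw [e]
    exact greenForm_finset_sum Finset.univ c (fun i => v i ∘ ofComplex) _
      (fun i _ => ((hv i).contDiffAt (hO.mem_nhds hz)).differentiableAt (by norm_num)) dw
  rw [intervalIntegral.integral_congr hpt]
  rw [intervalIntegral.integral_finsetSum fun i _ => ?_]
  · exact Finset.sum_congr rfl fun i _ => intervalIntegral.integral_const_mul _ _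
  · have hcont := continuousOn_greenForm_segment (hv i) (contDiffOn_hypPoissonKernelCpow s t) a b dw
    exact hcont.intervalIntegrable.const_mul (c i)

variable {p : ℕ}

/-- **stub_heckePeriodIntertwining** (registered stub; child `HeckePeriodIntertwining`, crux), PROVED:
the period cocycle of `T'_p u` is the double-coset sum of the slashed two-point periods of `u`, off the
poles of the `M_j` — linearity, the `p + 1` pull-backs, and `p^{-1/2} (det M_j)^{1/2} = 1`.
[cite: BruggemanLewisZagier2015, (2.25) p. 16 and (5.5a) p. 29] -/
theorem stub_heckePeriodIntertwining : let IsQuarterCuspForm : ℕ → (UpperHalfPlane → ℂ) → Prop := fun N u => Literature.NumberTheory.Automorphic.IsC2 u ∧ (∀ γ ∈ CongruenceSubgroup.Gamma1 N, ∀ z : UpperHalfPlane, u (γ • z) = u z) ∧ (∀ z : UpperHalfPlane, Literature.NumberTheory.Automorphic.hypLaplacian u z + (1 / 4 : ℂ) * u z = 0) ∧ ∃ C : ℝ, ∀ z : UpperHalfPlane, ‖u z‖ ≤ C; ∀ N : ℕ, 0 < N → ∀ p : ℕ, p.Prime → ¬ p ∣ N → ∀ σ ∈ CongruenceSubgroup.Gamma0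 N, (((σ : Matrix (Fin 2) (Fin 2) ℤ) 1 1 : ℤ) : ZMod N) = (p : ZMod N) → let M : Fin (p + 1) → Matrix (Fin 2) (Fin 2) ℤ := (fun j : Fin (p + 1) => if (j : ℕ) < p then !![(1 : ℤ), ((j : ℕ) : ℤ); 0, (p : ℤ)] else (σ : Matrix (Fin 2) (Fin 2) ℤ) * !![(p : ℤ), 0; 0, 1]); let A : Fin (p + 1) → UpperHalfPlane → UpperHalfPlane := (fun (j : Fin (p + 1)) (z : UpperHalfPlane) => if (j : ℕ) < p then UpperHalfPlane.ofComplex (((z : ℂ) + ((j : ℕ) : ℂ)) / (p : ℂ)) else σ • UpperHalfPlane.ofComplex ((p : ℂ) * (z : ℂ))); ∀ u : UpperHalfPlane → ℂ, IsQuarterCuspForm N u → ∀ γ : Matrix.SpecialLinearGroup (Fin 2) ℤ, ∀ᶠ t in Filter.cofinite, Literature.NumberTheory.Automorphic.lewisZagierCocycle (1 / 2) UpperHalfPlane.I (fun z : UpperHalfPlane => ((Real.sqrt p : ℝ) : ℂ)⁻¹ * (∑ b ∈ Finset.range p, u (UpperHalfPlane.ofComplex (((z : ℂ) + b) / p)) +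 u (σ • UpperHalfPlane.ofComplex ((p : ℂ) * (z : ℂ))))) (Matrix.SpecialLinearGroup.mapGL ℝ γ) t = ∑ j : Fin (p + 1), Literature.NumberTheory.Automorphic.slashHalf (M j) (Literature.NumberTheory.Automorphic.greenPeriod (1 / 2) u (A j (γ⁻¹ • UpperHalfPlane.I)) (A j UpperHalfPlane.I)) t := by
  intro IsQCF N hN p hp hpN σ hσ hσp M A u hu γ
  show ∀ᶠ t in cofinite,
    lewisZagierCocycle (1 / 2) UpperHalfPlane.I (heckeT p σ u) (Matrix.SpecialLinearGroup.mapGL ℝ γ) t =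
      ∑ j : Fin (p + 1), Literature.NumberTheory.Automorphic.slashHalf (heckeMat p σ j)
        (greenPeriod (1 / 2) u (heckeAct p σ j (γ⁻¹ • UpperHalfPlane.I)) (heckeAct p σ j UpperHalfPlane.I)) t
  obtain ⟨hC2, -, heig4, -⟩ := (hu : IsQuarterCuspFormR N u)
  have hp0 : (0 : ℝ) < p := by exact_mod_cast hp.pos
  have heig : ∀ z : ℍ, hypLaplacian u z + (1 / 2 : ℂ) * (1 - 1 / 2) * u z = 0 := fun z => by
    have h := heig4 z
    rw [← h]; norm_num
  have hcancel : ∀ j : Fin (p + 1),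
      ((Real.sqrt p : ℝ) : ℂ)⁻¹ * (((heckeGL σ hp j).det.val : ℝ) : ℂ) ^ (1 / 2 : ℂ) = 1 := by
    intro j
    have hdet : ((heckeGL σ hp j).det.val : ℝ) = (p : ℝ) := by
      unfold heckeGL; rw [glOfDet_det, heckeMat_det σ hp j]; push_cast; rfl
    rw [hdet, show (1 / 2 : ℂ) = ((1 / 2 : ℝ) : ℂ) by norm_num, ← Complex.ofReal_cpow hp0.le,
      ← Real.sqrt_eq_rpow]
    have hs : ((Real.sqrt p : ℝ) : ℂ) ≠ 0 := by exact_mod_cast (Real.sqrt_pos.mpr hp0).ne'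
    exact inv_mul_cancel₀ hs
  have hpoles : ∀ᶠ t in cofinite, ∀ j : Fin (p + 1),
      (heckeGL σ hp j) 1 0 * t + (heckeGL σ hp j) 1 1 ≠ 0 :=
    Filter.eventually_all.mpr fun j => eventually_cofinite_ne_linePole (heckeGL σ hp j)
  filter_upwards [hpoles] with t ht
  rw [lewisZagierCocycle, heckeT_eq_sum hp σ u,
    greenPeriod_finset_sum (1 / 2) (fun _ => ((Real.sqrt p : ℝ) : ℂ)⁻¹) (fun j z => u (heckeGL σ hp j • z))
      (fun j => isC2_comp_smul hC2 (heckeGL_det_pos σ hp j))]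
  refine Finset.sum_congr rfl fun j _ => ?_
  rw [greenPeriod_comp_smul one_half_ne_zero' one_half_ne_one' (heckeGL_det_pos σ hp j) hC2 heig _ _ (ht j),
    ← mul_assoc, hcancel j, one_mul, slashHalf_heckeMat hp σ j, heckeAct_eq_smul σ hp j, heckeAct_eq_smul σ hp j,
    sl_smul_eq_mapGL_smul, map_inv]

end PeriodLaws

/-! ## Registered stubs (= the split children, verbatim) and the composition -/

section Registered




/-- **COMPOSITION (registered form)**: the crux `HeckePreservesRationalPeriods` (route decl, BY NAME)
from the three registered stubs, through the sorry-free `heckePreservesRationalPeriods_of_subs`. [folklore] -/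
theorem HeckePreservesRationalPeriods_of : HeckePreservesRationalPeriods :=
  (heckePreservesRationalPeriods_of_subs :
      HeckeStableQuarterForms → HeckeCosetPermutation → HeckePeriodIntertwining → HeckePreservesRationalPeriods)
    stub_heckeStableQuarterForms stub_heckeCosetPermutation stub_heckePeriodIntertwining

end Registered

end Summit.Langlands.Langlands.Cruxes.HeckePreservesRationalPeriods.Decomposition
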